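import Literature.RepresentationTheory.CompactGroups.UnitaryTrick
import HarnessLib

/-!
# The exponential map of a compact connected matrix group is surjective

Topic `Literature/RepresentationTheory/CompactGroups`. Elementary Lie theory of a *closed unitary
matrix group* `S ⊆ M_n(ℂ)` (`MatrixLie.IsClosedUnitaryGroup`: closed, consisting of unitary
matrices, containing `1`, closed under products and `ᴴ`) — the setting to which every compact group
with a faithful finite-dimensional continuous representation reduces by Weyl's unitarian trick
(`CompactGroup.unitarize`, `UnitaryTrick.lean`). Mathlib (at this pin) has no Lie-group structure
on closed matrix groups and no maximal-torus theory; this file proves, from scratch and without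
algebraic topology:

1. `MatrixLie.lieAlg` — the **Lie algebra** `L(S) = {X | exp(tX) ∈ S ∀ t}` is a real subspace of
   skew-Hermitian matrices, `Ad(S)`-stable and closed under brackets (tangent vectors of curves,
   via the limit lemma `mem_lieSet_of_tendsto`; Bröcker–tom Dieck I (3.11)).
2. `MatrixLie.exists_forall_mlog_mem` — **von Neumann's closed-subgroup theorem**: elements of `S`
   near `1` have their logarithm in `L(S)` (inverse function theorem for `(X, P) ↦ exp X exp P`,
   compactness of the unit sphere of a complement, the limit lemma); hence `S` is locally
   `exp L(S)` (`exists_chart`) and an open-subgroup argument (`eq_of_subgroup_of_nhds_one`).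
3. `MatrixLie.exists_isRegular` — **regular elements**: some `Y₀ ∈ L(S)` has abelian centraliser
   `𝔷(Y₀)` (minimise `dim 𝔷(Y)`; `ker ad Y ∩ im ad Y = 0` for skew `Y` by `ad`-invariance of the
   trace form; a determinant-continuity perturbation `Y₀ + ε X₁`).
4. `MatrixLie.exists_adR_conj_eq_zero` — **Hunt's lemma**: for `X, Y ∈ L(S)` some `Ad(g) X`
   commutes with `Y` (maximise `Re tr (g X gᴴ Yᴴ)` over the compact `S`; first variation).
5. `MatrixLie.isClosed_exp_centralizer`, `MatrixLie.exp_image_eq_conj_image` — `T = exp 𝔷(Y₀)` is a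
   closed connected abelian subgroup and `exp L(S) = ⋃_g gᴴ T g` is compact.
6. `MatrixLie.subset_exp_image_of_finrank_eq`, `MatrixLie.eq_exp_image` — **surjectivity of `exp`**
   for connected `S` (Bröcker–tom Dieck IV (2.2), there a corollary of the main theorem on maximal
   tori IV (1.6), proved in the book by a mapping-degree argument). Here by strong induction on
   `dim L(S)`: `E = exp L(S)` is closed, and open in `S` — near `t ∈ T`, if `t` is central then
   `t · exp L(S) ⊆ E` by Hunt's lemma; otherwise the identity component `H` of the centraliser of
   `t` has smaller dimension, so `H = exp L(H) ⊆ E` by induction, and the **submersion lemma**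
   `MatrixLie.exists_nhds_subset_of_conj_invariant` (`(Z, Y) ↦ exp Z · t exp Y · exp(-Z)` has onto
   differential at `0` because `L(S) = 𝔷(t) ⊕ (Ad(t⁻¹) - 1) L(S)`) makes `E` a neighbourhood of
   `t`; connectedness of `S` gives `E = S`. Consequence
   (`mem_identityComponent_centralizer`): every `z ∈ S` lies in the identity component of its own
   centraliser.
7. `MatrixLie.exists_abelian_centralizer`, `MatrixLie.exists_abelian_centralizer_of_faithful` — an
   elementary proof of Bröcker–tom Dieck IV (2.3)(i) (**an element with abelian centraliser**;
   `Z(T) = T` for the maximal torus `T = exp 𝔷(Y₀)`): with `g₀ = exp (s Y₀)`, `s` small, if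
   `z g₀ = g₀ z` then `Ad(z) Y₀ = Y₀` (injectivity of `exp` near `0`), `z` is central in the
   identity component `K` of its centraliser, `Y₀ ∈ L(K)`, `z = exp X'` with `X' ∈ L(K)` (step 6
   for `K`), and Hunt's lemma in `K` rewrites `z = exp W` with `W ∈ 𝔷(Y₀)`, which is abelian. The
   named facts `compactLie_exists_abelian_centralizer` / `ExistsAbelianCentralizer` of
   `MaximalTorusCentralizer.lean` are already discharged in `MaximalTorusCentralizerProofs.lean` by
   the algebraic-group road (Zariski closure, Springer 7.6.4 (ii)); item 7 is an independent
   Lie-theoretic proof of the same statement and is not re-declared under those names.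

Everything here is proved; the definitions (`IsClosedUnitaryGroup`, `mlog`, `lieSet`, `lieAlg`,
`adR`, `centralizerL`, `reTrCLM`, `huntFun`, `subAd`) are proof infrastructure with their API.
Norms: the `L^∞`-operator norm on matrices (`open scoped Matrix.Norms.Operator`), as in the other
matrix-exponential files of the tree; all statements are norm-independent. Not here: maximal tori
as such, their conjugacy, the Weyl group, Kronecker generators (I (4.13) is replaced by the small
exponential `exp (s Y₀)` of a regular element).

## References

* [BrockerTomDieck1985] T. Bröcker, T. tom Dieck, *Representations of Compact Lie Groups*, GTM 98,
  Springer (1985): I (3.11) (closed subgroups), IV (1.6) (main theorem on maximal tori), IV (2.2)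
  (surjectivity of `exp`), IV (2.3)(i) (`Z(T) = T`).
* J. von Neumann, *Über die analytischen Eigenschaften von Gruppen linearer Transformationen und
  ihrer Darstellungen*, Math. Z. 30 (1929), 3–42 (the closed-subgroup theorem for matrix groups).
* G. A. Hunt, *A theorem of Élie Cartan*, Proc. Amer. Math. Soc. 7 (1956), 307–308 (the
  variational lemma).
-/

noncomputable section

open scoped Matrix.Norms.Operator ComplexOrder
open NormedSpace Matrix Topology Filter Set

namespace Literature.RepresentationTheory.CompactGroups

namespace MatrixLie

variable {ι : Type*} [Fintype ι] [DecidableEq ι]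

/-! ### Closed unitary matrix groups -/

/-- A **closed unitary matrix group**: a closed set of unitary matrices containing `1` and closed
under products and conjugate transposition (= inversion). [folklore] -/
structure IsClosedUnitaryGroup (S : Set (Matrix ι ι ℂ)) : Prop where
  one_mem : (1 : Matrix ι ι ℂ) ∈ S
  mul_mem : ∀ ⦃a b : Matrix ι ι ℂ⦄, a ∈ S → b ∈ S → a * b ∈ S
  star_mem : ∀ ⦃a : Matrix ι ι ℂ⦄, a ∈ S → aᴴ ∈ S
  mem_unitary : ∀ ⦃a : Matrix ι ι ℂ⦄, a ∈ S → a ∈ Matrix.unitaryGroup ι ℂ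
  isClosed : IsClosed S

namespace IsClosedUnitaryGroup

variable {S : Set (Matrix ι ι ℂ)}

/-- `aᴴ a = 1` for `a ∈ S`. [folklore] -/
theorem star_mul_self (hS : IsClosedUnitaryGroup S) {a : Matrix ι ι ℂ} (ha : a ∈ S) :
    aᴴ * a = 1 :=
  Matrix.mem_unitaryGroup_iff'.1 (hS.mem_unitary ha)

/-- `a aᴴ = 1` for `a ∈ S`. [folklore] -/
theorem mul_star_self (hS : IsClosedUnitaryGroup S) {a : Matrix ι ι ℂ} (ha : a ∈ S) :
    a * aᴴ = 1 :=
  Matrix.mem_unitaryGroup_iff.1 (hS.mem_unitary ha)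

/-- Elements of `S` are invertible. [folklore] -/
theorem isUnit (hS : IsClosedUnitaryGroup S) {a : Matrix ι ι ℂ} (ha : a ∈ S) : IsUnit a :=
  ⟨⟨a, aᴴ, hS.mul_star_self ha, hS.star_mul_self ha⟩, rfl⟩

/-- `a⁻¹ = aᴴ` for `a ∈ S`. [folklore] -/
theorem inv_eq_star (hS : IsClosedUnitaryGroup S) {a : Matrix ι ι ℂ} (ha : a ∈ S) :
    a⁻¹ = aᴴ :=
  Matrix.inv_eq_right_inv (hS.mul_star_self ha)

/-- `S` is closed under inversion. [folklore] -/
theorem inv_mem (hS : IsClosedUnitaryGroup S) {a : Matrix ι ι ℂ} (ha : a ∈ S) : a⁻¹ ∈ S := by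
  rw [hS.inv_eq_star ha]; exact hS.star_mem ha

/-- `S` is closed under powers. [folklore] -/
theorem pow_mem (hS : IsClosedUnitaryGroup S) {a : Matrix ι ι ℂ} (ha : a ∈ S) (n : ℕ) :
    a ^ n ∈ S := by
  induction n with
  | zero => simpa using hS.one_mem
  | succ n ih => rw [pow_succ]; exact hS.mul_mem ih ha

/-- `S` is closed under conjugation `a ↦ g a g⁻¹` by its elements. [folklore] -/
theorem conj_mem (hS : IsClosedUnitaryGroup S) {g a : Matrix ι ι ℂ} (hg : g ∈ S) (ha : a ∈ S) :
    g * a * g⁻¹ ∈ S :=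
  hS.mul_mem (hS.mul_mem hg ha) (hS.inv_mem hg)

/-- A closed unitary matrix group is compact (entries of unitary matrices are bounded by `1`).
[folklore] -/
theorem isCompact (hS : IsClosedUnitaryGroup S) : IsCompact S := by
  have hK : IsCompact (Set.pi Set.univ
      (fun _ : ι => Set.pi Set.univ (fun _ : ι => Metric.closedBall (0 : ℂ) 1))) :=
    isCompact_univ_pi fun _ => isCompact_univ_pi fun _ => isCompact_closedBall _ _
  refine IsCompact.of_isClosed_subset (X := Matrix ι ι ℂ) hK hS.isClosed fun A hA => ?_
  refine Set.mem_univ_pi.2 fun i => Set.mem_univ_pi.2 fun j => ?_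
  simpa using entry_norm_bound_of_unitary (hS.mem_unitary hA) i j

/-- `S` is non-empty. [folklore] -/
theorem nonempty (hS : IsClosedUnitaryGroup S) : S.Nonempty := ⟨1, hS.one_mem⟩

end IsClosedUnitaryGroup

/-! ### The matrix logarithm near `1` (local inverse of `exp`) -/

/-- `exp` has the identity as strict derivative at `0` (stated with a continuous linear
equivalence, as needed by the inverse function theorem). [folklore] -/
theorem hasStrictFDerivAt_exp_zero_equiv :
    HasStrictFDerivAt (exp : Matrix ι ι ℂ → Matrix ι ι ℂ)
      ((ContinuousLinearEquiv.refl ℝ (Matrix ι ι ℂ) : Matrix ι ι ℂ ≃L[ℝ] Matrix ι ι ℂ) :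
        Matrix ι ι ℂ →L[ℝ] Matrix ι ι ℂ) 0 :=
  (hasStrictFDerivAt_exp_zero (𝕂 := ℝ) (𝔸 := Matrix ι ι ℂ)).congr_fderiv (by ext1 x; rfl)

/-- The matrix logarithm near `1`: the local inverse of `exp` given by the inverse function theorem;
its values far from `1` are junk. [folklore] -/
def mlog : Matrix ι ι ℂ → Matrix ι ι ℂ :=
  (hasStrictFDerivAt_exp_zero_equiv (ι := ι)).localInverse exp _ 0

/-- `mlog (exp X) = X` for `X` near `0`. [folklore] -/
theorem mlog_exp_eventually : ∀ᶠ X in 𝓝 (0 : Matrix ι ι ℂ), mlog (exp X) = X :=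
  (hasStrictFDerivAt_exp_zero_equiv (ι := ι)).eventually_left_inverse

/-- `exp (mlog g) = g` for `g` near `1`. [folklore] -/
theorem exp_mlog_eventually : ∀ᶠ g in 𝓝 (1 : Matrix ι ι ℂ), exp (mlog g) = g := by
  have h := (hasStrictFDerivAt_exp_zero_equiv (ι := ι)).eventually_right_inverse
  rwa [exp_zero] at h

/-- `mlog 1 = 0`. [folklore] -/
theorem mlog_one : mlog (1 : Matrix ι ι ℂ) = 0 := by
  have h := (hasStrictFDerivAt_exp_zero_equiv (ι := ι)).localInverse_apply_image
  rwa [exp_zero] at h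

/-- `mlog` is continuous at `1` (with value `0`). [folklore] -/
theorem tendsto_mlog : Tendsto (mlog : Matrix ι ι ℂ → Matrix ι ι ℂ) (𝓝 1) (𝓝 0) := by
  have h := (hasStrictFDerivAt_exp_zero_equiv (ι := ι)).localInverse_tendsto
  rwa [exp_zero] at h

/-- `mlog` has the identity as strict derivative at `1`. [folklore] -/
theorem hasStrictFDerivAt_mlog :
    HasStrictFDerivAt (mlog : Matrix ι ι ℂ → Matrix ι ι ℂ) (1 : Matrix ι ι ℂ →L[ℝ] Matrix ι ι ℂ) 1 := by
  have h := (hasStrictFDerivAt_exp_zero_equiv (ι := ι)).to_localInverse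
  rw [exp_zero] at h
  exact h.congr_fderiv (by ext1 x; rfl)

/-- `exp` is injective on a ball around `0`. [folklore] -/
theorem exists_ball_injOn_exp :
    ∃ r > 0, Set.InjOn (exp : Matrix ι ι ℂ → Matrix ι ι ℂ) (Metric.ball 0 r) := by
  set e := (hasStrictFDerivAt_exp_zero_equiv (ι := ι)).toOpenPartialHomeomorph exp
  have h0 : (0 : Matrix ι ι ℂ) ∈ e.source :=
    (hasStrictFDerivAt_exp_zero_equiv (ι := ι)).mem_toOpenPartialHomeomorph_source
  obtain ⟨r, hr, hball⟩ := Metric.isOpen_iff.1 e.open_source 0 h0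
  exact ⟨r, hr, e.injOn.mono hball⟩

/-- `exp (n X) = (exp X)^n` with a real-scalar multiple. [folklore] -/
theorem exp_natCast_smul (n : ℕ) (X : Matrix ι ι ℂ) : exp ((n : ℝ) • X) = exp X ^ n := by
  rw [Nat.cast_smul_eq_nsmul]
  exact NormedSpace.exp_nsmul n X

/-! ### The Lie algebra of a closed unitary matrix group -/

/-- The set `L(S) = {X | exp(tX) ∈ S for all real t}` of infinitesimal generators of `S`
(the Lie algebra of the closed matrix group `S`, Bröcker–tom Dieck I (3.11)). [folklore] -/
def lieSet (S : Set (Matrix ι ι ℂ)) : Set (Matrix ι ι ℂ) :=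
  {X | ∀ t : ℝ, exp (t • X) ∈ S}

/-- Unfolding `lieSet`. [folklore] -/
theorem mem_lieSet {S : Set (Matrix ι ι ℂ)} {X : Matrix ι ι ℂ} :
    X ∈ lieSet S ↔ ∀ t : ℝ, exp (t • X) ∈ S := Iff.rfl

/-- `exp X ∈ S` for `X ∈ L(S)`. [folklore] -/
theorem exp_mem_of_mem_lieSet {S : Set (Matrix ι ι ℂ)} {X : Matrix ι ι ℂ} (hX : X ∈ lieSet S) :
    exp X ∈ S := by simpa using hX 1

/-- `L(S)` is closed under real scalars. [folklore] -/
theorem smul_mem_lieSet {S : Set (Matrix ι ι ℂ)} {X : Matrix ι ι ℂ} (hX : X ∈ lieSet S) (c : ℝ) :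
    c • X ∈ lieSet S := fun t => by rw [smul_smul]; exact hX _

/-- `0 ∈ L(S)`. [folklore] -/
theorem zero_mem_lieSet {S : Set (Matrix ι ι ℂ)} (hS : IsClosedUnitaryGroup S) :
    (0 : Matrix ι ι ℂ) ∈ lieSet S := fun t => by simpa using hS.one_mem

/-- `L(S)` is closed under negation. [folklore] -/
theorem neg_mem_lieSet {S : Set (Matrix ι ι ℂ)} {X : Matrix ι ι ℂ} (hX : X ∈ lieSet S) :
    -X ∈ lieSet S := by simpa using smul_mem_lieSet hX (-1)

/-- **Limit lemma** (the heart of the closed-subgroup theorem, Bröcker–tom Dieck I (3.11)):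
if `exp (X k) ∈ S` and `a k • X k → V` with `a k → +∞`, then `V ∈ L(S)`. [folklore] -/
theorem mem_lieSet_of_tendsto {S : Set (Matrix ι ι ℂ)} (hS : IsClosedUnitaryGroup S)
    {X : ℕ → Matrix ι ι ℂ} {a : ℕ → ℝ} {V : Matrix ι ι ℂ}
    (hX : ∀ᶠ k in atTop, exp (X k) ∈ S) (ha : Tendsto a atTop atTop)
    (hV : Tendsto (fun k => a k • X k) atTop (𝓝 V)) : V ∈ lieSet S := by
  -- first for `t ≥ 0`
  have key : ∀ t : ℝ, 0 ≤ t → exp (t • V) ∈ S := by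
    intro t ht
    have ha0 : ∀ᶠ k in atTop, 0 < a k := ha.eventually_gt_atTop 0
    -- `m k = ⌊t * a k⌋₊`, `(m k / a k) → t`
    set m : ℕ → ℕ := fun k => ⌊t * a k⌋₊ with hm
    have h1 : Tendsto (fun k => ((m k : ℝ) / a k)) atTop (𝓝 t) :=
      (tendsto_nat_floor_mul_div_atTop ht).comp ha
    have h2 : Tendsto (fun k => ((m k : ℝ) • X k)) atTop (𝓝 (t • V)) := by
      have : ∀ᶠ k in atTop, (m k : ℝ) • X k = ((m k : ℝ) / a k) • (a k • X k) := by
        filter_upwards [ha0] with k hk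
        rw [smul_smul, div_mul_cancel₀ _ hk.ne']
      rw [tendsto_congr' this]
      exact h1.smul hV
    have h3 : ∀ᶠ k in atTop, exp ((m k : ℝ) • X k) ∈ S := by
      filter_upwards [hX] with k hk
      rw [exp_natCast_smul]
      exact hS.pow_mem hk _
    have h4 : Tendsto (fun k => exp ((m k : ℝ) • X k)) atTop (𝓝 (exp (t • V))) :=
      (NormedSpace.exp_continuous.tendsto _).comp h2
    exact hS.isClosed.mem_of_tendsto h4 h3
  intro t
  rcases le_or_gt 0 t with ht | ht
  · exact key t ht
  · have h := key (-t) (by linarith)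
    have h' := hS.star_mem h
    rw [← hS.inv_eq_star h, ← Matrix.exp_neg] at h'
    simpa using h'


section LieAlgebra

variable {S : Set (Matrix ι ι ℂ)}

/-- **Tangent vectors of curves in `S` lie in `L(S)`**: if `γ` takes values in `S` near `0`,
`γ 0 = 1` and `γ` has derivative `V` at `0`, then `V ∈ L(S)` (via the logarithmic chart and the
limit lemma). [folklore] -/
theorem mem_lieSet_of_hasDerivAt (hS : IsClosedUnitaryGroup S) {γ : ℝ → Matrix ι ι ℂ}
    {V : Matrix ι ι ℂ} (hγS : ∀ᶠ s in 𝓝 0, γ s ∈ S) (hγ0 : γ 0 = 1) (hγ : HasDerivAt γ V 0) :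
    V ∈ lieSet S := by
  set W : ℝ → Matrix ι ι ℂ := fun s => mlog (γ s) with hW_def
  have hW : HasDerivAt W V 0 := by
    have h1 : HasStrictFDerivAt mlog (1 : Matrix ι ι ℂ →L[ℝ] Matrix ι ι ℂ) (γ 0) := by
      rw [hγ0]; exact hasStrictFDerivAt_mlog
    exact h1.hasFDerivAt.comp_hasDerivAt 0 hγ
  have hc : Tendsto γ (𝓝 0) (𝓝 1) := by
    have h := hγ.continuousAt.tendsto
    rw [hγ0] at h
    exact h
  have hexpW : ∀ᶠ s in 𝓝 0, exp (W s) = γ s := hc.eventually exp_mlog_eventually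
  have hW0 : W 0 = 0 := by simp only [hW_def, hγ0, mlog_one]
  have hslope : Tendsto (fun s => s⁻¹ • W s) (𝓝[≠] 0) (𝓝 V) := by
    have h := hasDerivAt_iff_tendsto_slope_zero.1 hW
    simp only [zero_add, hW0, sub_zero] at h
    exact h
  have hseq : Tendsto (fun k : ℕ => (1 : ℝ) / ((k : ℝ) + 1)) atTop (𝓝[≠] 0) :=
    tendsto_nhdsWithin_iff.2 ⟨tendsto_one_div_add_atTop_nhds_zero_nat,
      Eventually.of_forall fun k => by rw [mem_compl_singleton_iff]; positivity⟩
  refine mem_lieSet_of_tendsto hS (X := fun k => W (1 / ((k : ℝ) + 1)))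
    (a := fun k => (k : ℝ) + 1) ?_ ?_ ?_
  · have h2 := (hseq.mono_right nhdsWithin_le_nhds).eventually (hexpW.and hγS)
    filter_upwards [h2] with k hk
    rw [hk.1]; exact hk.2
  · exact tendsto_atTop_add_const_right _ 1 tendsto_natCast_atTop_atTop
  · refine (hslope.comp hseq).congr fun k => ?_
    simp

/-- The Lie algebra `L(S)` of a closed unitary matrix group, as a real subspace of `M_n(ℂ)`
(closure under sums: the curve `s ↦ exp(sX) exp(sY)` has tangent `X + Y`). [folklore] -/
def lieAlg (hS : IsClosedUnitaryGroup S) : Submodule ℝ (Matrix ι ι ℂ) where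
  carrier := lieSet S
  zero_mem' := zero_mem_lieSet hS
  add_mem' := fun {X Y} hX hY => by
    refine mem_lieSet_of_hasDerivAt hS (γ := fun s => exp (s • X) * exp (s • Y))
      (Eventually.of_forall fun s => hS.mul_mem (hX s) (hY s))
      (by simp only [zero_smul, exp_zero, mul_one]) ?_
    have h := (hasDerivAt_exp_smul_const X (0 : ℝ)).mul (hasDerivAt_exp_smul_const Y (0 : ℝ))
    simp only [zero_smul, exp_zero, mul_one, one_mul] at h
    exact h
  smul_mem' := fun c X hX => smul_mem_lieSet hX c

/-- Unfolding `lieAlg`. [folklore] -/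
theorem mem_lieAlg (hS : IsClosedUnitaryGroup S) {X : Matrix ι ι ℂ} :
    X ∈ lieAlg hS ↔ ∀ t : ℝ, exp (t • X) ∈ S := Iff.rfl

/-- The carrier of `lieAlg` is `lieSet`. [folklore] -/
theorem coe_lieAlg (hS : IsClosedUnitaryGroup S) : (lieAlg hS : Set (Matrix ι ι ℂ)) = lieSet S :=
  rfl

/-- `L(S)` is closed (finite-dimensional subspace). [folklore] -/
theorem isClosed_lieAlg (hS : IsClosedUnitaryGroup S) : IsClosed (lieAlg hS : Set (Matrix ι ι ℂ)) :=
  (lieAlg hS).closed_of_finiteDimensional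

/-- `L(S)` is stable under conjugation by elements of `S` (the adjoint action). [folklore] -/
theorem conj_mem_lieAlg (hS : IsClosedUnitaryGroup S) {g X : Matrix ι ι ℂ} (hg : g ∈ S)
    (hX : X ∈ lieAlg hS) : g * X * g⁻¹ ∈ lieAlg hS := fun t => by
  rw [show t • (g * X * g⁻¹) = g * (t • X) * g⁻¹ by rw [Matrix.mul_smul, Matrix.smul_mul],
    Matrix.exp_conj _ _ (hS.isUnit hg)]
  exact hS.conj_mem hg (hX t)

/-- Elements of `L(S)` are skew-Hermitian (`S` consists of unitary matrices). [folklore] -/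
theorem conjTranspose_eq_neg (hS : IsClosedUnitaryGroup S) {X : Matrix ι ι ℂ} (hX : X ∈ lieAlg hS) :
    Xᴴ = -X := by
  have hconst : ∀ s : ℝ, exp (s • Xᴴ) * exp (s • X) = 1 := fun s => by
    have h := hS.star_mul_self (hX s)
    rwa [← Matrix.exp_conjTranspose, conjTranspose_smul, star_trivial] at h
  have h1 : HasDerivAt (fun s : ℝ => exp (s • Xᴴ) * exp (s • X)) (Xᴴ + X) 0 := by
    have h := (hasDerivAt_exp_smul_const Xᴴ (0 : ℝ)).mul (hasDerivAt_exp_smul_const X (0 : ℝ))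
    simp only [zero_smul, exp_zero, mul_one, one_mul] at h
    exact h
  have h2 : HasDerivAt (fun s : ℝ => exp (s • Xᴴ) * exp (s • X)) 0 0 := by
    simp_rw [hconst]; exact hasDerivAt_const _ _
  exact eq_neg_of_add_eq_zero_left (h1.unique h2)

/-- The derivative at `0` of `s ↦ exp(sX) Y exp(-sX)` is the commutator `XY - YX`. [folklore] -/
theorem hasDerivAt_conj_exp (X Y : Matrix ι ι ℂ) :
    HasDerivAt (fun s : ℝ => exp (s • X) * Y * exp (s • (-X))) (X * Y - Y * X) 0 := by
  have h := ((hasDerivAt_exp_smul_const X (0 : ℝ)).mul_const Y).mul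
    (hasDerivAt_exp_smul_const (-X) (0 : ℝ))
  simp only [zero_smul, exp_zero, mul_one, one_mul, Matrix.mul_neg, ← sub_eq_add_neg] at h
  exact h

omit [DecidableEq ι] in
/-- The derivative at `0` of a curve lying in a subspace lies in that subspace. [folklore] -/
theorem mem_of_hasDerivAt_of_forall_mem (K : Submodule ℝ (Matrix ι ι ℂ)) {γ : ℝ → Matrix ι ι ℂ}
    {V : Matrix ι ι ℂ} (hγ : ∀ s, γ s ∈ K) (hd : HasDerivAt γ V 0) : V ∈ K := by
  have hc : IsClosed (K : Set (Matrix ι ι ℂ)) := K.closed_of_finiteDimensional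
  have ht := hasDerivAt_iff_tendsto_slope_zero.1 hd
  exact hc.mem_of_tendsto ht (Eventually.of_forall fun t => K.smul_mem _ (K.sub_mem (hγ _) (hγ _)))

/-- `L(S)` is closed under the commutator bracket. [folklore] -/
theorem lie_mem_lieAlg (hS : IsClosedUnitaryGroup S) {X Y : Matrix ι ι ℂ} (hX : X ∈ lieAlg hS)
    (hY : Y ∈ lieAlg hS) : X * Y - Y * X ∈ lieAlg hS := by
  have hcurve : ∀ s : ℝ, exp (s • X) * Y * exp (s • (-X)) ∈ lieAlg hS := fun s => by
    have h := conj_mem_lieAlg hS (hX s) hY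
    rwa [← Matrix.exp_neg, ← smul_neg] at h
  exact mem_of_hasDerivAt_of_forall_mem (lieAlg hS) hcurve (hasDerivAt_conj_exp X Y)

/-- A matrix commuting with `exp(tW)` for all `t` commutes with `W`. [folklore] -/
theorem commute_of_forall_commute_exp {M W : Matrix ι ι ℂ} (h : ∀ t : ℝ, M * exp (t • W) = exp (t • W) * M) :
    M * W = W * M := by
  have h1 : HasDerivAt (fun t : ℝ => M * exp (t • W)) (M * W) 0 := by
    have h := (hasDerivAt_exp_smul_const W (0 : ℝ)).const_mul M
    simp only [zero_smul, exp_zero, one_mul] at h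
    exact h
  have h2 : HasDerivAt (fun t : ℝ => exp (t • W) * M) (W * M) 0 := by
    have h := (hasDerivAt_exp_smul_const' W (0 : ℝ)).mul_const M
    simp only [zero_smul, exp_zero, mul_one] at h
    exact h
  simp_rw [h] at h1
  exact h1.unique h2

/-- `exp (-A) * exp A = 1`. [folklore] -/
theorem exp_neg_mul_exp (A : Matrix ι ι ℂ) : exp (-A) * exp A = 1 := by
  rw [← Matrix.exp_add_of_commute _ _ (Commute.refl A).neg_left, neg_add_cancel, exp_zero]

/-- `exp A * exp (-A) = 1`. [folklore] -/
theorem exp_mul_exp_neg (A : Matrix ι ι ℂ) : exp A * exp (-A) = 1 := by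
  rw [← Matrix.exp_add_of_commute _ _ (Commute.refl A).neg_right, add_neg_cancel, exp_zero]

/-! ### von Neumann's theorem: `S` is locally the image of `L(S)` under `exp` -/

/-- **The closed-subgroup theorem for unitary matrix groups** (von Neumann; Bröcker–tom Dieck
I (3.11)): there is `ε > 0` such that every `g ∈ S` with `‖g - 1‖ < ε` has `log g ∈ L(S)`.
Proof: otherwise, splitting `M_n(ℂ) = L(S) ⊕ P` and inverting the chart `(X, p) ↦ exp X exp p`,
one produces `p_k → 0`, `p_k ≠ 0` in `P` with `exp p_k ∈ S`; a limit point of `p_k/‖p_k‖` lies in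
`L(S) ∩ P = 0` by the limit lemma, a contradiction. [cite: BrockerTomDieck1985, I (3.11)] -/
theorem exists_forall_mlog_mem (hS : IsClosedUnitaryGroup S) :
    ∃ ε > 0, ∀ g ∈ S, dist g 1 < ε → mlog g ∈ lieAlg hS := by
  by_contra hcon
  push Not at hcon
  set L := lieAlg hS with hL
  obtain ⟨P, hLP⟩ := L.exists_isCompl
  set e : (L × P) ≃L[ℝ] Matrix ι ι ℂ :=
    (Submodule.prodEquivOfIsCompl L P hLP).toContinuousLinearEquiv with he
  set Φ : L × P → Matrix ι ι ℂ := fun q => exp (q.1 : Matrix ι ι ℂ) * exp (q.2 : Matrix ι ι ℂ)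
    with hΦ_def
  have hΦ0 : Φ 0 = 1 := by simp [hΦ_def]
  have hΦ : HasStrictFDerivAt Φ (e : L × P →L[ℝ] Matrix ι ι ℂ) 0 := by
    have hA : HasStrictFDerivAt (fun q : L × P => exp (q.1 : Matrix ι ι ℂ))
        (L.subtypeL.comp (ContinuousLinearMap.fst ℝ L P)) 0 := by
      have hl := (L.subtypeL.comp (ContinuousLinearMap.fst ℝ L P)).hasStrictFDerivAt (x := 0)
      have h0 : HasStrictFDerivAt (exp : Matrix ι ι ℂ → Matrix ι ι ℂ) (1 : Matrix ι ι ℂ →L[ℝ] Matrix ι ι ℂ)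
          ((L.subtypeL.comp (ContinuousLinearMap.fst ℝ L P)) 0) := by
        rw [map_zero]
        exact hasStrictFDerivAt_exp_zero (𝕂 := ℝ) (𝔸 := Matrix ι ι ℂ)
      exact (h0.comp 0 hl).congr_fderiv (by
        rw [ContinuousLinearMap.one_def]; exact ContinuousLinearMap.id_comp _)
    have hB : HasStrictFDerivAt (fun q : L × P => exp (q.2 : Matrix ι ι ℂ))
        (P.subtypeL.comp (ContinuousLinearMap.snd ℝ L P)) 0 := by
      have hl := (P.subtypeL.comp (ContinuousLinearMap.snd ℝ L P)).hasStrictFDerivAt (x := 0)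
      have h0 : HasStrictFDerivAt (exp : Matrix ι ι ℂ → Matrix ι ι ℂ) (1 : Matrix ι ι ℂ →L[ℝ] Matrix ι ι ℂ)
          ((P.subtypeL.comp (ContinuousLinearMap.snd ℝ L P)) 0) := by
        rw [map_zero]
        exact hasStrictFDerivAt_exp_zero (𝕂 := ℝ) (𝔸 := Matrix ι ι ℂ)
      exact (h0.comp 0 hl).congr_fderiv (by
        rw [ContinuousLinearMap.one_def]; exact ContinuousLinearMap.id_comp _)
    refine (hA.mul' hB).congr_fderiv ?_
    refine ContinuousLinearMap.ext fun q => ?_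
    simp [he]
    change (q.2 : Matrix ι ι ℂ) + (q.1 : Matrix ι ι ℂ) = (q.1 : Matrix ι ι ℂ) + (q.2 : Matrix ι ι ℂ)
    exact add_comm _ _
  set H := hΦ.toOpenPartialHomeomorph Φ with hH
  have hsrc : (0 : L × P) ∈ H.source := hΦ.mem_toOpenPartialHomeomorph_source
  have htgt : (1 : Matrix ι ι ℂ) ∈ H.target := by
    simpa [hΦ0] using hΦ.image_mem_toOpenPartialHomeomorph_target
  have hHΦ : (H : L × P → Matrix ι ι ℂ) = Φ := rfl
  -- a sequence `g k ∈ S`, `g k → 1`, `mlog (g k) ∉ L`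
  choose g hgS hgd hgL using fun k : ℕ => hcon (1 / ((k : ℝ) + 1)) (by positivity)
  have hg1 : Tendsto g atTop (𝓝 1) :=
    tendsto_iff_dist_tendsto_zero.2 <| squeeze_zero (fun k => dist_nonneg) (fun k => (hgd k).le)
      tendsto_one_div_add_atTop_nhds_zero_nat
  -- invert the chart along the sequence
  set q : ℕ → L × P := fun k => H.symm (g k) with hq
  have hq0 : Tendsto q atTop (𝓝 0) := by
    have h1 : Tendsto H.symm (𝓝 1) (𝓝 (H.symm 1)) := (H.continuousAt_symm htgt).tendsto
    have h2 : H.symm 1 = 0 := by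
      have := H.left_inv hsrc
      rwa [hHΦ, hΦ0] at this
    rw [← h2]
    exact h1.comp hg1
  have hΦq : ∀ᶠ k in atTop, Φ (q k) = g k := by
    filter_upwards [hg1.eventually (H.open_target.mem_nhds htgt)] with k hk
    rw [← hHΦ]
    exact H.right_inv hk
  -- the `P`-components are eventually non-zero
  have hq1 : Tendsto (fun k => ((q k).1 : Matrix ι ι ℂ)) atTop (𝓝 0) := by
    have : Continuous fun x : L × P => ((x.1 : L) : Matrix ι ι ℂ) := by fun_prop
    have h := (this.tendsto 0).comp hq0
    simp only [Prod.fst_zero, ZeroMemClass.coe_zero] at h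
    exact h
  have hq2 : Tendsto (fun k => ((q k).2 : Matrix ι ι ℂ)) atTop (𝓝 0) := by
    have : Continuous fun x : L × P => ((x.2 : P) : Matrix ι ι ℂ) := by fun_prop
    have h := (this.tendsto 0).comp hq0
    simp only [Prod.snd_zero, ZeroMemClass.coe_zero] at h
    exact h
  have hne : ∀ᶠ k in atTop, (q k).2 ≠ 0 := by
    filter_upwards [hΦq, hq1.eventually mlog_exp_eventually] with k hk hk' h0
    apply hgL k
    rw [← hk, hΦ_def]
    dsimp only
    rw [h0]
    simp only [ZeroMemClass.coe_zero, exp_zero, mul_one]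
    rw [hk']
    exact (q k).1.2
  -- `exp (p k) ∈ S`
  have hexp : ∀ᶠ k in atTop, exp ((q k).2 : Matrix ι ι ℂ) ∈ S := by
    filter_upwards [hΦq] with k hk
    have h1 : exp (-((q k).1 : Matrix ι ι ℂ)) ∈ S := by
      have := (L.neg_mem (q k).1.2)
      exact exp_mem_of_mem_lieSet this
    have h2 : exp (-((q k).1 : Matrix ι ι ℂ)) * g k = exp ((q k).2 : Matrix ι ι ℂ) := by
      rw [← hk, hΦ_def]
      dsimp only
      rw [← mul_assoc, exp_neg_mul_exp, one_mul]
    rw [← h2]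
    exact hS.mul_mem h1 (hgS k)
  -- normalise and extract a convergent subsequence on the unit sphere of `P`
  set u : ℕ → P := fun k => (‖(q k).2‖⁻¹ : ℝ) • (q k).2 with hu
  have husphere : ∀ᶠ k in atTop, u k ∈ Metric.sphere (0 : P) 1 := by
    filter_upwards [hne] with k hk
    rw [mem_sphere_zero_iff_norm, hu]
    dsimp only
    rw [norm_smul, norm_inv, norm_norm, inv_mul_cancel₀ (norm_ne_zero_iff.2 hk)]
  obtain ⟨w, hw, φ, hφ, hlim⟩ := (isCompact_sphere (0 : P) 1).tendsto_subseq' husphere.frequently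
  -- the limit lemma puts `w` in `L`
  have hwL : (w : Matrix ι ι ℂ) ∈ lieSet S := by
    refine mem_lieSet_of_tendsto hS (X := fun k => ((q (φ k)).2 : Matrix ι ι ℂ))
      (a := fun k => ‖(q (φ k)).2‖⁻¹) ?_ ?_ ?_
    · exact hφ.tendsto_atTop.eventually hexp
    · have h1 : Tendsto (fun k => ‖(q (φ k)).2‖) atTop (𝓝[>] 0) := by
        refine tendsto_nhdsWithin_iff.2 ⟨?_, ?_⟩
        · have h := (continuous_norm.tendsto (0 : Matrix ι ι ℂ)).comp (hq2.comp hφ.tendsto_atTop)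
          rw [norm_zero] at h
          exact h
        · filter_upwards [hφ.tendsto_atTop.eventually hne] with k hk
          exact norm_pos_iff.2 hk
      exact tendsto_inv_nhdsGT_zero.comp h1
    · have h1 : Tendsto (fun k => ((u (φ k) : P) : Matrix ι ι ℂ)) atTop (𝓝 (w : Matrix ι ι ℂ)) :=
        (continuous_subtype_val.tendsto w).comp hlim
      refine h1.congr fun k => ?_
      simp [hu]
  have hw0 : (w : Matrix ι ι ℂ) = 0 := by
    have h1 : (w : Matrix ι ι ℂ) ∈ L ⊓ P := ⟨hwL, w.2⟩
    rwa [hLP.inf_eq_bot, Submodule.mem_bot] at h1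
  have : ‖w‖ = 1 := mem_sphere_zero_iff_norm.1 hw
  rw [show w = 0 from Subtype.ext hw0, norm_zero] at this
  exact zero_ne_one this

/-- **`S` is locally `exp L(S)`**: there is `ε > 0` such that every `g ∈ S` with `dist g 1 < ε`
satisfies `mlog g ∈ L(S)` and `exp (mlog g) = g`. [cite: BrockerTomDieck1985, I (3.11)] -/
theorem exists_chart (hS : IsClosedUnitaryGroup S) :
    ∃ ε > 0, ∀ g ∈ S, dist g 1 < ε → mlog g ∈ lieAlg hS ∧ exp (mlog g) = g := by
  obtain ⟨ε, hε, h⟩ := exists_forall_mlog_mem hS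
  obtain ⟨δ, hδ, h'⟩ := Metric.eventually_nhds_iff.1 (exp_mlog_eventually (ι := ι))
  exact ⟨min ε δ, lt_min hε hδ, fun g hg hd =>
    ⟨h g hg (hd.trans_le (min_le_left _ _)), h' (hd.trans_le (min_le_right _ _))⟩⟩

/-- Elements of `S` near `1` are exponentials of elements of `L(S)`. [folklore] -/
theorem exists_nhds_subset_exp_image (hS : IsClosedUnitaryGroup S) :
    ∃ ε > 0, ∀ g ∈ S, dist g 1 < ε → ∃ X ∈ lieAlg hS, exp X = g := by
  obtain ⟨ε, hε, h⟩ := exists_chart hS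
  exact ⟨ε, hε, fun g hg hd => ⟨mlog g, (h g hg hd).1, (h g hg hd).2⟩⟩

/-- **`exp` of a neighbourhood of `0` in `L(S)` is a neighbourhood of `1` in `S`.** [folklore] -/
theorem exists_nhds_subset_exp_image_of_mem_nhds (hS : IsClosedUnitaryGroup S)
    {U : Set (Matrix ι ι ℂ)} (hU : U ∈ 𝓝 (0 : Matrix ι ι ℂ)) :
    ∃ ε > 0, ∀ g ∈ S, dist g 1 < ε → ∃ X ∈ lieAlg hS, X ∈ U ∧ exp X = g := by
  obtain ⟨ε, hε, h⟩ := exists_chart hS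
  obtain ⟨δ, hδ, h'⟩ := Metric.eventually_nhds_iff.1 (tendsto_mlog.eventually hU)
  exact ⟨min ε δ, lt_min hε hδ, fun g hg hd =>
    ⟨mlog g, (h g hg (hd.trans_le (min_le_left _ _))).1, h' (hd.trans_le (min_le_right _ _)),
      (h g hg (hd.trans_le (min_le_left _ _))).2⟩⟩

end LieAlgebra


/-! ### The adjoint action on the Lie algebra; regular elements -/

section Regular

variable {S : Set (Matrix ι ι ℂ)}

/-- `ad Y : X ↦ YX - XY` as a real-linear endomorphism of `M_n(ℂ)`. [folklore] -/
def adR (Y : Matrix ι ι ℂ) : Matrix ι ι ℂ →ₗ[ℝ] Matrix ι ι ℂ :=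
  LinearMap.mulLeft ℝ Y - LinearMap.mulRight ℝ Y

/-- Unfolding `adR`. [folklore] -/
@[simp] theorem adR_apply (Y X : Matrix ι ι ℂ) : adR Y X = Y * X - X * Y := rfl

/-- `ad` is additive in its first argument. [folklore] -/
theorem adR_add (Y₁ Y₂ : Matrix ι ι ℂ) : adR (Y₁ + Y₂) = adR Y₁ + adR Y₂ := by
  ext1 X; simp only [adR_apply, LinearMap.add_apply]; noncomm_ring

/-- `ad` is homogeneous in its first argument. [folklore] -/
theorem adR_smul (c : ℝ) (Y : Matrix ι ι ℂ) : adR (c • Y) = c • adR Y := by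
  ext1 X; simp only [adR_apply, LinearMap.smul_apply, smul_sub, Matrix.smul_mul, Matrix.mul_smul]

/-- Jacobi: `ad Y (ad X W) - ad X (ad Y W) = ad [Y, X] W`. [folklore] -/
theorem adR_adR_sub (Y X W : Matrix ι ι ℂ) :
    adR Y (adR X W) - adR X (adR Y W) = adR (adR Y X) W := by
  simp only [adR_apply]; noncomm_ring

/-- `ad Y` and `ad X` commute when `[Y, X] = 0`. [folklore] -/
theorem adR_comm_of_adR_eq_zero {Y X : Matrix ι ι ℂ} (h : adR Y X = 0) (W : Matrix ι ι ℂ) :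
    adR Y (adR X W) = adR X (adR Y W) := by
  have := adR_adR_sub Y X W
  rw [h] at this
  simpa [sub_eq_zero] using this

/-- **`ad`-invariance of the trace form**: `tr (ad Y A · B) = - tr (A · ad Y B)`. [folklore] -/
theorem trace_adR_mul (Y A B : Matrix ι ι ℂ) :
    (adR Y A * B).trace = -(A * adR Y B).trace := by
  simp only [adR_apply, sub_mul, mul_sub, trace_sub, Matrix.mul_assoc, neg_sub]
  rw [Matrix.trace_mul_comm Y (A * B), Matrix.mul_assoc]

/-- Conjugate transpose of a commutator with a skew-Hermitian matrix. [folklore] -/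
theorem conjTranspose_adR {Y W : Matrix ι ι ℂ} (hY : Yᴴ = -Y) : (adR Y W)ᴴ = adR Y Wᴴ := by
  simp only [adR_apply, conjTranspose_sub, conjTranspose_mul, hY]; noncomm_ring

/-- **`ker (ad Y) ∩ im (ad Y) = 0` for skew-Hermitian `Y`**: if `[Y, [Y, W]] = 0` then
`[Y, W] = 0` (`ad Y` is skew for the positive definite trace form `Re tr (Vᴴ V)`). [folklore] -/
theorem adR_eq_zero_of_adR_adR_eq_zero {Y W : Matrix ι ι ℂ} (hY : Yᴴ = -Y)
    (h : adR Y (adR Y W) = 0) : adR Y W = 0 := by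
  set V := adR Y W with hV
  have h1 : (Vᴴ * V).trace = 0 := by
    rw [hV, conjTranspose_adR hY, trace_adR_mul, ← hV, h, Matrix.mul_zero, trace_zero, neg_zero]
  exact Matrix.trace_conjTranspose_mul_self_eq_zero_iff.1 h1

/-- The centraliser `𝔷(Y) = {X ∈ L(S) | [Y, X] = 0}` of `Y` in `L(S)`. [folklore] -/
def centralizerL (hS : IsClosedUnitaryGroup S) (Y : Matrix ι ι ℂ) : Submodule ℝ (Matrix ι ι ℂ) :=
  lieAlg hS ⊓ LinearMap.ker (adR Y)

/-- Unfolding `centralizerL`. [folklore] -/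
theorem mem_centralizerL (hS : IsClosedUnitaryGroup S) {Y X : Matrix ι ι ℂ} :
    X ∈ centralizerL hS Y ↔ X ∈ lieAlg hS ∧ adR Y X = 0 := by
  simp only [centralizerL, Submodule.mem_inf, LinearMap.mem_ker]

/-- A perturbation lemma for determinants: if `A` is injective on a finite-dimensional real
space, so is `A + ε B` for some `ε ≠ 0` (continuity of `ε ↦ det (A + ε B)`). [folklore] -/
theorem exists_ne_zero_injective {V : Type*} [AddCommGroup V] [Module ℝ V] [FiniteDimensional ℝ V]
    (A B : V →ₗ[ℝ] V) (hA : Function.Injective A) :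
    ∃ ε : ℝ, ε ≠ 0 ∧ Function.Injective (A + ε • B) := by
  classical
  let b := Module.finBasis ℝ V
  set f : ℝ → ℝ := fun ε => (LinearMap.toMatrix b b (A + ε • B)).det with hf_def
  have hf : Continuous f := by
    have : ∀ ε : ℝ, LinearMap.toMatrix b b (A + ε • B) =
        LinearMap.toMatrix b b A + ε • LinearMap.toMatrix b b B := fun ε => by
      rw [map_add, LinearEquiv.map_smul]
    simp_rw [hf_def, this]
    exact (continuous_const.add (continuous_id.smul continuous_const)).matrix_det
  have hf0 : f 0 ≠ 0 := by
    simp only [hf_def, zero_smul, add_zero, LinearMap.det_toMatrix]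
    have hu : IsUnit A := (LinearMap.isUnit_iff_ker_eq_bot A).2 (LinearMap.ker_eq_bot.2 hA)
    exact ((LinearMap.isUnit_iff_isUnit_det A).1 hu).ne_zero
  obtain ⟨δ, hδ, hball⟩ := Metric.isOpen_iff.1 (isOpen_ne.preimage hf) 0 hf0
  refine ⟨δ / 2, by positivity, ?_⟩
  have hne : f (δ / 2) ≠ 0 := hball (by
    rw [Metric.mem_ball, Real.dist_eq, sub_zero, abs_of_pos (by positivity)]; linarith)
  have hu : IsUnit (LinearMap.det (A + (δ / 2) • B)) := by
    rw [← LinearMap.det_toMatrix b]; exact isUnit_iff_ne_zero.2 hne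
  exact LinearMap.ker_eq_bot.1
    ((LinearMap.isUnit_iff_ker_eq_bot _).1 ((LinearMap.isUnit_iff_isUnit_det _).2 hu))

/-- For a skew-Hermitian `Y`, `M_n(ℂ) = ker (ad Y) ⊕ im (ad Y)`: the two are disjoint … [folklore] -/
theorem disjoint_ker_range_adR {Y : Matrix ι ι ℂ} (hY : Yᴴ = -Y) :
    Disjoint (LinearMap.ker (adR Y)) (LinearMap.range (adR Y)) := by
  rw [Submodule.disjoint_def]
  rintro V hV ⟨W, rfl⟩
  exact adR_eq_zero_of_adR_adR_eq_zero hY hV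

/-- … and together span everything (rank–nullity). [folklore] -/
theorem ker_sup_range_adR {Y : Matrix ι ι ℂ} (hY : Yᴴ = -Y) :
    LinearMap.ker (adR Y) ⊔ LinearMap.range (adR Y) = ⊤ := by
  apply Submodule.eq_top_of_finrank_eq
  have h1 := Submodule.finrank_sup_add_finrank_inf_eq (LinearMap.ker (adR Y)) (LinearMap.range (adR Y))
  rw [(disjoint_ker_range_adR hY).eq_bot, finrank_bot, add_zero, add_comm,
    LinearMap.finrank_range_add_finrank_ker] at h1
  exact h1

/-- **Perturbation of a commuting pair**: for `Y` skew-Hermitian and `X` with `[Y, X] = 0` there is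
`ε ≠ 0` with `ker (ad (Y + ε X)) ⊆ ker (ad Y) ∩ ker (ad X)`. [folklore] -/
theorem exists_ker_adR_add_smul_le {Y X : Matrix ι ι ℂ} (hY : Yᴴ = -Y) (hYX : adR Y X = 0) :
    ∃ ε : ℝ, ε ≠ 0 ∧ ∀ W, adR (Y + ε • X) W = 0 → adR Y W = 0 ∧ adR X W = 0 := by
  have hcomm : ∀ W, adR Y (adR X W) = adR X (adR Y W) := adR_comm_of_adR_eq_zero hYX
  have hAR : ∀ v ∈ LinearMap.range (adR Y), adR Y v ∈ LinearMap.range (adR Y) :=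
    fun v _ => LinearMap.mem_range_self _ v
  have hBR : ∀ v ∈ LinearMap.range (adR Y), adR X v ∈ LinearMap.range (adR Y) := by
    rintro _ ⟨w, rfl⟩; exact ⟨adR X w, hcomm w⟩
  have hBK : ∀ v ∈ LinearMap.ker (adR Y), adR X v ∈ LinearMap.ker (adR Y) := fun v hv => by
    rw [LinearMap.mem_ker] at hv ⊢
    rw [hcomm, hv, map_zero]
  have hdis := disjoint_ker_range_adR hY
  have hinj : Function.Injective ((adR Y).restrict hAR) := by
    intro v w hvw
    apply Subtype.ext
    have h1 : adR Y (v - w : Matrix ι ι ℂ) = 0 := by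
      have := congrArg Subtype.val hvw
      simp only [LinearMap.coe_restrict_apply] at this
      rw [map_sub, this, sub_self]
    have h2 : (v - w : Matrix ι ι ℂ) ∈ LinearMap.ker (adR Y) ⊓ LinearMap.range (adR Y) :=
      ⟨h1, Submodule.sub_mem _ v.2 w.2⟩
    rw [hdis.eq_bot, Submodule.mem_bot] at h2
    exact sub_eq_zero.1 h2
  obtain ⟨ε, hε, hinj'⟩ := exists_ne_zero_injective _ ((adR X).restrict hBR) hinj
  refine ⟨ε, hε, fun W hW => ?_⟩
  have hW' : adR Y W + ε • adR X W = 0 := by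
    rwa [adR_add, adR_smul, LinearMap.add_apply, LinearMap.smul_apply] at hW
  -- decompose `W = k + r` along `ker ⊕ range`
  have hmem : W ∈ LinearMap.ker (adR Y) ⊔ LinearMap.range (adR Y) := by
    rw [ker_sup_range_adR hY]; exact Submodule.mem_top
  obtain ⟨k, hk, r, hr, rfl⟩ := Submodule.mem_sup.1 hmem
  have hAk : adR Y k = 0 := hk
  have h1 : adR Y r + ε • adR X r = -(ε • adR X k) := by
    rw [map_add, map_add, hAk, zero_add, smul_add] at hW'
    rw [eq_neg_iff_add_eq_zero, ← hW']; abel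
  have h2 : adR Y r + ε • adR X r ∈ LinearMap.ker (adR Y) ⊓ LinearMap.range (adR Y) := by
    refine ⟨?_, Submodule.add_mem _ (hAR r hr) (Submodule.smul_mem _ _ (hBR r hr))⟩
    rw [h1]; exact Submodule.neg_mem _ (Submodule.smul_mem _ _ (hBK k hk))
  rw [hdis.eq_bot, Submodule.mem_bot] at h2
  have hr0 : r = 0 := by
    have h3 : ((adR Y).restrict hAR + ε • (adR X).restrict hBR) ⟨r, hr⟩ = 0 := by
      apply Subtype.ext
      simp only [LinearMap.add_apply, LinearMap.smul_apply, Submodule.coe_add,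
        Submodule.coe_smul, LinearMap.coe_restrict_apply, ZeroMemClass.coe_zero]
      exact h2
    have h4 := hinj' (h3.trans (map_zero _).symm)
    simpa using congrArg Subtype.val h4
  subst hr0
  have hBk : adR X k = 0 := by
    rw [map_zero, map_zero, smul_zero, add_zero, eq_comm, neg_eq_zero, smul_eq_zero] at h1
    exact h1.resolve_left hε
  simp [hAk, hBk]

/-- **Regular elements of `L(S)`**: there is `Y₀ ∈ L(S)` whose centraliser in `L(S)` is abelian
(an element minimising `dim 𝔷(Y)`; if `𝔷(Y₀)` contained non-commuting `X₁, X₂`, a perturbation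
`Y₀ + ε X₁` would have a strictly smaller centraliser). [folklore] -/
theorem exists_isRegular (hS : IsClosedUnitaryGroup S) :
    ∃ Y₀ ∈ lieAlg hS, ∀ X₁ ∈ centralizerL hS Y₀, ∀ X₂ ∈ centralizerL hS Y₀, X₁ * X₂ = X₂ * X₁ := by
  set d : Matrix ι ι ℂ → ℕ := fun Y => Module.finrank ℝ (centralizerL hS Y) with hd
  set m := sInf (d '' (lieAlg hS : Set (Matrix ι ι ℂ))) with hm
  obtain ⟨Y₀, hY₀, hdY₀⟩ : ∃ Y₀ ∈ lieAlg hS, d Y₀ = m :=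
    Nat.sInf_mem (Set.image_nonempty.2 ⟨0, (lieAlg hS).zero_mem⟩)
  have hmin : ∀ Y ∈ lieAlg hS, d Y₀ ≤ d Y := fun Y hY => by
    rw [hdY₀]; exact Nat.sInf_le ⟨Y, hY, rfl⟩
  refine ⟨Y₀, hY₀, fun X₁ hX₁ X₂ hX₂ => ?_⟩
  by_contra hne
  rw [mem_centralizerL] at hX₁ hX₂
  obtain ⟨ε, hε, hker⟩ := exists_ker_adR_add_smul_le (conjTranspose_eq_neg hS hY₀) hX₁.2
  have hmem : Y₀ + ε • X₁ ∈ lieAlg hS := (lieAlg hS).add_mem hY₀ ((lieAlg hS).smul_mem _ hX₁.1)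
  have hlt : centralizerL hS (Y₀ + ε • X₁) < centralizerL hS Y₀ := by
    refine lt_of_le_of_ne (fun W hW => ?_) (fun heq => hne ?_)
    · rw [mem_centralizerL] at hW ⊢
      exact ⟨hW.1, (hker W hW.2).1⟩
    · have hX₂' : X₂ ∈ centralizerL hS (Y₀ + ε • X₁) := by
        rw [heq, mem_centralizerL]; exact hX₂
      rw [mem_centralizerL] at hX₂'
      exact sub_eq_zero.1 (hker X₂ hX₂'.2).2
  exact absurd (hmin _ hmem) (not_le.2 (Submodule.finrank_lt_finrank_of_lt hlt))

end Regular


/-! ### Hunt's lemma -/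

section Hunt

variable {S : Set (Matrix ι ι ℂ)}

omit [DecidableEq ι] in
/-- `A ↦ Re tr A` as a continuous real-linear functional. [folklore] -/
def reTrCLM : Matrix ι ι ℂ →L[ℝ] ℝ :=
  Complex.reCLM.comp (LinearMap.toContinuousLinearMap (Matrix.traceLinearMap ι ℝ ℂ))

omit [DecidableEq ι] in
/-- Unfolding `reTrCLM`. [folklore] -/
@[simp] theorem reTrCLM_apply (A : Matrix ι ι ℂ) : reTrCLM A = A.trace.re := rfl

omit [DecidableEq ι] in
/-- The function extremised in Hunt's lemma: `F(g) = Re tr (g X gᴴ · Yᴴ) = ⟨Ad(g) X, Y⟩`. [folklore] -/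
def huntFun (X Y g : Matrix ι ι ℂ) : ℝ := ((g * X * gᴴ) * Yᴴ).trace.re

omit [DecidableEq ι] in
/-- `huntFun X Y` is continuous. [folklore] -/
theorem continuous_huntFun (X Y : Matrix ι ι ℂ) : Continuous (huntFun X Y) := by
  unfold huntFun
  exact Complex.continuous_re.comp
    ((((continuous_id.matrix_mul continuous_const).matrix_mul
      continuous_id.matrix_conjTranspose).matrix_mul continuous_const).matrix_trace)

omit [DecidableEq ι] in
/-- A matrix `V` with `Re tr (Vᴴ V) = 0` vanishes. [folklore] -/
theorem eq_zero_of_re_trace_conjTranspose_mul_self {V : Matrix ι ι ℂ}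
    (h : ((Vᴴ * V).trace).re = 0) : V = 0 := by
  have hreal : (((Vᴴ * V).trace).re : ℂ) = (Vᴴ * V).trace := by
    rw [← Complex.conj_eq_iff_re, starRingEnd_apply, ← Matrix.trace_conjTranspose,
      conjTranspose_mul, conjTranspose_conjTranspose]
  have h0 : (Vᴴ * V).trace = 0 := by rw [← hreal, h, Complex.ofReal_zero]
  exact Matrix.trace_conjTranspose_mul_self_eq_zero_iff.1 h0

/-- **Hunt's lemma** (G. A. Hunt 1956; the variational substitute for the main theorem on
maximal tori): for `X, Y ∈ L(S)` there is `g ∈ S` with `[Ad(g) X, Y] = 0`. At a maximum `g₀` on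
the compact `S` of `g ↦ ⟨Ad(g)X, Y⟩` the derivative along `s ↦ exp(sZ) g₀` vanishes:
`⟨[Z, Ad(g₀)X], Y⟩ = ⟨Z, [Ad(g₀)X, Y]⟩ = 0` for all `Z ∈ L(S)`; take `Z = [Ad(g₀)X, Y]`. [folklore] -/
theorem exists_adR_conj_eq_zero (hS : IsClosedUnitaryGroup S) {X Y : Matrix ι ι ℂ}
    (hX : X ∈ lieAlg hS) (hY : Y ∈ lieAlg hS) : ∃ g ∈ S, adR (g * X * g⁻¹) Y = 0 := by
  obtain ⟨g₀, hg₀S, hmax⟩ :=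
    hS.isCompact.exists_isMaxOn hS.nonempty (continuous_huntFun X Y).continuousOn
  refine ⟨g₀, hg₀S, ?_⟩
  have hX'L : g₀ * X * g₀⁻¹ ∈ lieAlg hS := conj_mem_lieAlg hS hg₀S hX
  have hYH : Yᴴ = -Y := conjTranspose_eq_neg hS hY
  -- first variation
  have hderiv : ∀ Z ∈ lieAlg hS, ((adR Z (g₀ * X * g₀⁻¹)) * Yᴴ).trace.re = 0 := by
    intro Z hZ
    have hZH : Zᴴ = -Z := conjTranspose_eq_neg hS hZ
    have hφmax : IsLocalMax (fun s : ℝ => huntFun X Y (exp (s • Z) * g₀)) 0 := by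
      refine Filter.Eventually.of_forall fun s => ?_
      have h1 := hmax (hS.mul_mem (hZ s) hg₀S)
      simp only [zero_smul, exp_zero, one_mul]
      exact h1
    have hfun : (fun s : ℝ => huntFun X Y (exp (s • Z) * g₀)) =
        fun s => reTrCLM ((exp (s • Z) * (g₀ * X * g₀⁻¹) * exp (s • (-Z))) * Yᴴ) := by
      funext s
      simp only [huntFun, reTrCLM_apply]
      rw [conjTranspose_mul, ← Matrix.exp_conjTranspose, conjTranspose_smul, star_trivial, hZH,
        ← hS.inv_eq_star hg₀S]
      simp only [Matrix.mul_assoc]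
    have hφd : HasDerivAt (fun s : ℝ => huntFun X Y (exp (s • Z) * g₀))
        (reTrCLM ((Z * (g₀ * X * g₀⁻¹) - (g₀ * X * g₀⁻¹) * Z) * Yᴴ)) 0 := by
      rw [hfun]
      exact reTrCLM.hasFDerivAt.comp_hasDerivAt 0 ((hasDerivAt_conj_exp Z _).mul_const Yᴴ)
    have := hφmax.hasDerivAt_eq_zero hφd
    rwa [reTrCLM_apply, ← adR_apply] at this
  -- take `Z = [Ad(g₀)X, Y]`
  set V := adR (g₀ * X * g₀⁻¹) Y with hV
  have hVL : V ∈ lieAlg hS := lie_mem_lieAlg hS hX'L hY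
  have hVH : Vᴴ = -V := conjTranspose_eq_neg hS hVL
  have h1 := hderiv V hVL
  -- `tr ([V, X'] Yᴴ) = tr ([X', V] Y) = - tr (V [X', Y]) = - tr (V V) = tr (Vᴴ V)`
  have h2 : ((adR V (g₀ * X * g₀⁻¹)) * Yᴴ).trace = (Vᴴ * V).trace := by
    have ha : adR V (g₀ * X * g₀⁻¹) * Yᴴ = adR (g₀ * X * g₀⁻¹) V * Y := by
      rw [hYH, adR_apply, adR_apply]; noncomm_ring
    rw [ha, trace_adR_mul, ← hV, hVH, Matrix.neg_mul]
    simp only [trace_neg]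
  rw [h2] at h1
  exact eq_zero_of_re_trace_conjTranspose_mul_self h1

end Hunt


/-! ### Closed unitary groups built from others; connectedness -/

section Constructions

variable {S : Set (Matrix ι ι ℂ)}

namespace IsClosedUnitaryGroup

/-- The closure of a set of unitary matrices containing `1` and closed under products and `ᴴ` is a
closed unitary matrix group. [folklore] -/
theorem closure {A : Set (Matrix ι ι ℂ)} (h1 : (1 : Matrix ι ι ℂ) ∈ A)
    (hmul : ∀ ⦃a b⦄, a ∈ A → b ∈ A → a * b ∈ A) (hstar : ∀ ⦃a⦄, a ∈ A → aᴴ ∈ A)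
    (hU : ∀ ⦃a⦄, a ∈ A → a ∈ Matrix.unitaryGroup ι ℂ) : IsClosedUnitaryGroup (closure A) where
  one_mem := subset_closure h1
  mul_mem := by
    intro a b ha hb
    have hc : Continuous fun p : Matrix ι ι ℂ × Matrix ι ι ℂ => p.1 * p.2 := by fun_prop
    have : (a, b) ∈ _root_.closure (A ×ˢ A) := by rw [closure_prod_eq]; exact ⟨ha, hb⟩
    exact (image_closure_subset_closure_image hc) ⟨(a, b), this, rfl⟩ |>
      closure_mono (by rintro _ ⟨⟨x, y⟩, ⟨hx, hy⟩, rfl⟩; exact hmul hx hy)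
  star_mem := by
    intro a ha
    have hc : Continuous fun p : Matrix ι ι ℂ => pᴴ := by fun_prop
    exact (image_closure_subset_closure_image hc) ⟨a, ha, rfl⟩ |>
      closure_mono (by rintro _ ⟨x, hx, rfl⟩; exact hstar hx)
  mem_unitary := by
    intro a ha
    have hcl : IsClosed (Matrix.unitaryGroup ι ℂ : Set (Matrix ι ι ℂ)) := by
      have : (Matrix.unitaryGroup ι ℂ : Set (Matrix ι ι ℂ)) = {a | aᴴ * a = 1} := by
        ext a; exact Matrix.mem_unitaryGroup_iff'
      rw [this]
      exact isClosed_eq (by fun_prop) continuous_const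
    exact closure_minimal (fun x hx => hU hx) hcl ha
  isClosed := isClosed_closure

omit [DecidableEq ι] in
/-- The closure of a commutative set of matrices is commutative. [folklore] -/
theorem _root_.Literature.RepresentationTheory.CompactGroups.MatrixLie.commute_of_mem_closure
    {A : Set (Matrix ι ι ℂ)} (hA : ∀ a ∈ A, ∀ b ∈ A, a * b = b * a) {a b : Matrix ι ι ℂ}
    (ha : a ∈ _root_.closure A) (hb : b ∈ _root_.closure A) : a * b = b * a := by
  have hcl : IsClosed {p : Matrix ι ι ℂ × Matrix ι ι ℂ | p.1 * p.2 = p.2 * p.1} :=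
    isClosed_eq (by fun_prop) (by fun_prop)
  have hsub : A ×ˢ A ⊆ {p : Matrix ι ι ℂ × Matrix ι ι ℂ | p.1 * p.2 = p.2 * p.1} :=
    fun p hp => hA _ hp.1 _ hp.2
  have : (a, b) ∈ _root_.closure (A ×ˢ A) := by rw [closure_prod_eq]; exact ⟨ha, hb⟩
  exact closure_minimal hsub hcl this

/-- The centraliser `Z_S(t) = {g ∈ S | g t = t g}` of a matrix in a closed unitary matrix group.
[folklore] -/
theorem centralizer (hS : IsClosedUnitaryGroup S) (t : Matrix ι ι ℂ) :
    IsClosedUnitaryGroup {g ∈ S | g * t = t * g} where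
  one_mem := ⟨hS.one_mem, by simp⟩
  mul_mem := fun a b ha hb => ⟨hS.mul_mem ha.1 hb.1, by
    rw [Matrix.mul_assoc, hb.2, ← Matrix.mul_assoc, ha.2, Matrix.mul_assoc]⟩
  star_mem := fun a ha => ⟨hS.star_mem ha.1, by
    have h := ha.2
    calc aᴴ * t = aᴴ * t * (a * aᴴ) := by rw [hS.mul_star_self ha.1, Matrix.mul_one]
      _ = aᴴ * (t * a) * aᴴ := by simp only [Matrix.mul_assoc]
      _ = aᴴ * (a * t) * aᴴ := by rw [h]
      _ = t * aᴴ := by rw [← Matrix.mul_assoc, hS.star_mul_self ha.1, Matrix.one_mul]⟩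
  mem_unitary := fun a ha => hS.mem_unitary ha.1
  isClosed := hS.isClosed.inter (isClosed_eq (by fun_prop) (by fun_prop))

/-- The identity component `S₀ = ` connected component of `1` in `S`. [folklore] -/
theorem identityComponent (hS : IsClosedUnitaryGroup S) :
    IsClosedUnitaryGroup (connectedComponentIn S 1) where
  one_mem := mem_connectedComponentIn hS.one_mem
  mul_mem := by
    intro a b ha hb
    have hc : Continuous fun p : Matrix ι ι ℂ × Matrix ι ι ℂ => p.1 * p.2 := by fun_prop
    have hconn : IsPreconnected ((fun p : Matrix ι ι ℂ × Matrix ι ι ℂ => p.1 * p.2) ''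
        (connectedComponentIn S 1 ×ˢ connectedComponentIn S 1)) :=
      (isPreconnected_connectedComponentIn.prod isPreconnected_connectedComponentIn).image _
        hc.continuousOn
    have hsub := hconn.subset_connectedComponentIn (x := 1)
      ⟨(1, 1), ⟨mem_connectedComponentIn hS.one_mem, mem_connectedComponentIn hS.one_mem⟩, by simp⟩
      (by
        rintro _ ⟨⟨x, y⟩, ⟨hx, hy⟩, rfl⟩
        exact hS.mul_mem (connectedComponentIn_subset _ _ hx) (connectedComponentIn_subset _ _ hy))
    exact hsub ⟨(a, b), ⟨ha, hb⟩, rfl⟩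
  star_mem := by
    intro a ha
    have hc : Continuous fun p : Matrix ι ι ℂ => pᴴ := by fun_prop
    have hconn : IsPreconnected ((fun p : Matrix ι ι ℂ => pᴴ) '' connectedComponentIn S 1) :=
      isPreconnected_connectedComponentIn.image _ hc.continuousOn
    have hsub := hconn.subset_connectedComponentIn (x := 1)
      ⟨1, mem_connectedComponentIn hS.one_mem, by simp⟩
      (by rintro _ ⟨x, hx, rfl⟩; exact hS.star_mem (connectedComponentIn_subset _ _ hx))
    exact hsub ⟨a, ha, rfl⟩
  mem_unitary := fun a ha => hS.mem_unitary (connectedComponentIn_subset _ _ ha)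
  isClosed := by
    rw [← closure_subset_iff_isClosed]
    refine (isPreconnected_connectedComponentIn.closure).subset_connectedComponentIn
      (subset_closure (mem_connectedComponentIn hS.one_mem)) ?_
    exact (closure_mono (connectedComponentIn_subset S 1)).trans hS.isClosed.closure_subset

end IsClosedUnitaryGroup

/-- The identity component is connected. [folklore] -/
theorem isConnected_identityComponent (hS : IsClosedUnitaryGroup S) :
    IsConnected (connectedComponentIn S 1) :=
  isConnected_connectedComponentIn_iff.2 hS.one_mem

omit [Fintype ι] in
/-- A continuous curve in `S` through `1` (defined on `ℝ`) lies in the identity component.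
[folklore] -/
theorem curve_subset_identityComponent {γ : ℝ → Matrix ι ι ℂ} (hγ : Continuous γ)
    (h0 : γ 0 = 1) (hS : ∀ s, γ s ∈ S) (s : ℝ) : γ s ∈ connectedComponentIn S 1 := by
  have hconn : IsPreconnected (Set.range γ) := isPreconnected_range hγ
  exact hconn.subset_connectedComponentIn ⟨0, h0⟩ (by rintro _ ⟨s, rfl⟩; exact hS s) ⟨s, rfl⟩

/-- `exp (s X)` lies in the identity component of `S` for `X ∈ L(S)`. [folklore] -/
theorem exp_mem_identityComponent (hS : IsClosedUnitaryGroup S) {X : Matrix ι ι ℂ}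
    (hX : X ∈ lieAlg hS) (s : ℝ) : exp (s • X) ∈ connectedComponentIn S 1 :=
  curve_subset_identityComponent (γ := fun s : ℝ => exp (s • X))
    (NormedSpace.exp_continuous.comp (continuous_id.smul continuous_const)) (by simp) hX s

/-- **An open subgroup of a connected group is everything** (set version): a subset `A ⊆ S`
containing `1`, closed under products and `ᴴ`, and containing all elements of `S` near `1`, is all
of `S` when `S` is connected. [folklore] -/
theorem eq_of_subgroup_of_nhds_one (hS : IsClosedUnitaryGroup S) (hconn : IsPreconnected S)
    {A : Set (Matrix ι ι ℂ)} (hAS : A ⊆ S) (h1 : (1 : Matrix ι ι ℂ) ∈ A)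
    (hmul : ∀ ⦃a b⦄, a ∈ A → b ∈ A → a * b ∈ A) (hstar : ∀ ⦃a⦄, a ∈ A → aᴴ ∈ A)
    {ε : ℝ} (hε : 0 < ε) (hnhd : ∀ g ∈ S, dist g 1 < ε → g ∈ A) : A = S := by
  -- the basic neighbourhoods `N b = {x | dist (bᴴ x) 1 < ε}`
  set N : Matrix ι ι ℂ → Set (Matrix ι ι ℂ) := fun b => {x | dist (bᴴ * x) 1 < ε} with hN
  have hNopen : ∀ b, IsOpen (N b) := fun b =>
    Metric.isOpen_ball.preimage (f := fun x => bᴴ * x) (by fun_prop)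
  have hNself : ∀ b ∈ S, b ∈ N b := fun b hb => by
    change dist (bᴴ * b) 1 < ε
    rw [hS.star_mul_self hb, dist_self]; exact hε
  have hNA : ∀ b ∈ S, ∀ x ∈ S, x ∈ N b → bᴴ * x ∈ A := fun b hb x hx hxN =>
    hnhd _ (hS.mul_mem (hS.star_mem hb) hx) hxN
  refine Subset.antisymm hAS fun x hx => ?_
  by_contra hxA
  set u : Set (Matrix ι ι ℂ) := ⋃ a ∈ A, N a
  set v : Set (Matrix ι ι ℂ) := ⋃ b ∈ S \ A, N b
  have hu : IsOpen u := isOpen_biUnion fun a _ => hNopen a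
  have hv : IsOpen v := isOpen_biUnion fun b _ => hNopen b
  have hSuv : S ⊆ u ∪ v := fun y hy => by
    by_cases hyA : y ∈ A
    · exact Or.inl (Set.mem_biUnion hyA (hNself y hy))
    · exact Or.inr (Set.mem_biUnion ⟨hy, hyA⟩ (hNself y hy))
  obtain ⟨y, hyS, hyu, hyv⟩ := hconn u v hu hv hSuv ⟨1, hS.one_mem, Set.mem_biUnion h1
    (hNself 1 hS.one_mem)⟩ ⟨x, hx, Set.mem_biUnion ⟨hx, hxA⟩ (hNself x hx)⟩
  obtain ⟨a, haA, hya⟩ := Set.mem_iUnion₂.1 hyu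
  obtain ⟨b, ⟨hbS, hbA⟩, hyb⟩ := Set.mem_iUnion₂.1 hyv
  -- `y = a (aᴴ y) ∈ A`, and then `b = (bᴴ)ᴴ = ((bᴴ y) yᴴ)ᴴ ∈ A`
  have hyA : y ∈ A := by
    have : y = a * (aᴴ * y) := by
      rw [← Matrix.mul_assoc, hS.mul_star_self (hAS haA), Matrix.one_mul]
    rw [this]; exact hmul haA (hNA a (hAS haA) y hyS hya)
  apply hbA
  have hb : b = (bᴴ * y * yᴴ)ᴴ := by
    rw [Matrix.mul_assoc, hS.mul_star_self hyS, Matrix.mul_one, conjTranspose_conjTranspose]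
  rw [hb]
  exact hstar (hmul (hNA b hbS y hyS hyb) (hstar hyA))

/-- In a connected closed unitary group, an element commuting with `exp X` for all `X ∈ L(S)`
is central. [folklore] -/
theorem central_of_forall_commute_exp (hS : IsClosedUnitaryGroup S) (hconn : IsPreconnected S)
    {t : Matrix ι ι ℂ} (ht : ∀ X ∈ lieAlg hS, t * exp X = exp X * t) :
    ∀ g ∈ S, g * t = t * g := by
  have hZ := hS.centralizer t
  obtain ⟨ε, hε, hnhd⟩ := exists_nhds_subset_exp_image hS
  have heq := eq_of_subgroup_of_nhds_one hS hconn (A := {g ∈ S | g * t = t * g})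
    (fun g hg => hg.1) hZ.one_mem hZ.mul_mem hZ.star_mem hε (fun g hg hd => by
      obtain ⟨X, hX, rfl⟩ := hnhd g hg hd
      exact ⟨hg, (ht X hX).symm⟩)
  intro g hg
  rw [← heq] at hg
  exact hg.2

/-- **Connected abelian closed unitary groups are exponential**: if `S` is connected and `L(S)`
is commutative then `S = exp L(S)`. [folklore] -/
theorem eq_exp_image_of_comm (hS : IsClosedUnitaryGroup S) (hconn : IsPreconnected S)
    (hcomm : ∀ X ∈ lieAlg hS, ∀ Y ∈ lieAlg hS, X * Y = Y * X) :
    S = exp '' (lieAlg hS : Set (Matrix ι ι ℂ)) := by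
  obtain ⟨ε, hε, hnhd⟩ := exists_nhds_subset_exp_image hS
  refine (eq_of_subgroup_of_nhds_one hS hconn (A := exp '' (lieAlg hS : Set (Matrix ι ι ℂ)))
    ?_ ⟨0, (lieAlg hS).zero_mem, exp_zero⟩ ?_ ?_ hε (fun g hg hd => ?_)).symm
  · rintro _ ⟨X, hX, rfl⟩; exact exp_mem_of_mem_lieSet hX
  · rintro _ _ ⟨X, hX, rfl⟩ ⟨Y, hY, rfl⟩
    exact ⟨X + Y, (lieAlg hS).add_mem hX hY,
      Matrix.exp_add_of_commute _ _ (hcomm X hX Y hY)⟩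
  · rintro _ ⟨X, hX, rfl⟩
    refine ⟨-X, (lieAlg hS).neg_mem hX, ?_⟩
    rw [← Matrix.exp_conjTranspose, conjTranspose_eq_neg hS hX]
  · obtain ⟨X, hX, rfl⟩ := hnhd g hg hd
    exact ⟨X, hX, rfl⟩

end Constructions


/-! ### Surjectivity of the exponential map: preparations -/

section ExpPrep

variable {S : Set (Matrix ι ι ℂ)}

/-- Antisymmetry of the commutator. [folklore] -/
theorem adR_eq_neg_adR (A B : Matrix ι ι ℂ) : adR A B = -adR B A := by
  simp only [adR_apply, neg_sub]

/-- `[A, B] = 0 ↔ [B, A] = 0`. [folklore] -/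
theorem adR_eq_zero_comm {A B : Matrix ι ι ℂ} : adR A B = 0 ↔ adR B A = 0 := by
  rw [adR_eq_neg_adR, neg_eq_zero]

omit [DecidableEq ι] in
/-- `U_t : X ↦ tᴴ X t - X` (`= Ad(t⁻¹) - 1` for unitary `t`) as a real-linear map. [folklore] -/
def subAd (t : Matrix ι ι ℂ) : Matrix ι ι ℂ →ₗ[ℝ] Matrix ι ι ℂ where
  toFun X := tᴴ * X * t - X
  map_add' X Y := by simp only [Matrix.mul_add, Matrix.add_mul]; abel
  map_smul' c X := by simp only [Matrix.mul_smul, Matrix.smul_mul, smul_sub, RingHom.id_apply]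

omit [DecidableEq ι] in
/-- Unfolding `subAd`. [folklore] -/
@[simp] theorem subAd_apply (t X : Matrix ι ι ℂ) : subAd t X = tᴴ * X * t - X := rfl

/-- **`ker U_t ∩ im U_t = 0` for unitary `t`** (`Ad(t⁻¹)` is an isometry of the trace form, so
`1` has no Jordan blocks): if `V = tᴴ W t - W` satisfies `tᴴ V t = V` then `V = 0`. [folklore] -/
theorem subAd_eq_zero_of_subAd_subAd_eq_zero {t W : Matrix ι ι ℂ} (ht' : t * tᴴ = 1)
    (h : subAd t (subAd t W) = 0) : subAd t W = 0 := by
  generalize hV : subAd t W = V at h ⊢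
  have hVW : V = tᴴ * W * t - W := by rw [← hV, subAd_apply]
  have hfix : tᴴ * V * t = V := by rwa [subAd_apply, sub_eq_zero] at h
  have hfix' : t * V * tᴴ = V := by
    calc t * V * tᴴ = t * (tᴴ * V * t) * tᴴ := by rw [hfix]
      _ = (t * tᴴ) * V * (t * tᴴ) := by simp only [Matrix.mul_assoc]
      _ = V := by rw [ht', Matrix.one_mul, Matrix.mul_one]
  have hVH : t * Vᴴ * tᴴ = Vᴴ := by
    have := congrArg conjTranspose hfix'
    simpa only [conjTranspose_mul, conjTranspose_conjTranspose, Matrix.mul_assoc] using this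
  have h1 : (Vᴴ * V).trace = 0 := by
    have h2 : Vᴴ * V = Vᴴ * (tᴴ * W * t) - Vᴴ * W := by rw [← Matrix.mul_sub, ← hVW]
    rw [h2, trace_sub, show Vᴴ * (tᴴ * W * t) = Vᴴ * tᴴ * W * t by simp only [Matrix.mul_assoc],
      Matrix.trace_mul_comm (Vᴴ * tᴴ * W) t, ← Matrix.mul_assoc, ← Matrix.mul_assoc, hVH, sub_self]
  exact Matrix.trace_conjTranspose_mul_self_eq_zero_iff.1 h1

/-- `U_t` preserves `L(S)` for `t ∈ S`. [folklore] -/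
theorem subAd_mem_lieAlg (hS : IsClosedUnitaryGroup S) {t X : Matrix ι ι ℂ} (ht : t ∈ S)
    (hX : X ∈ lieAlg hS) : subAd t X ∈ lieAlg hS := by
  rw [subAd_apply]
  refine (lieAlg hS).sub_mem ?_ hX
  have h := conj_mem_lieAlg hS (hS.star_mem ht) hX
  rwa [hS.inv_eq_star (hS.star_mem ht), conjTranspose_conjTranspose] at h

/-- `U_t X = 0` iff `X` commutes with `t` (unitary `t`). [folklore] -/
theorem subAd_eq_zero_iff (hS : IsClosedUnitaryGroup S) {t X : Matrix ι ι ℂ} (ht : t ∈ S) :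
    subAd t X = 0 ↔ X * t = t * X := by
  rw [subAd_apply, sub_eq_zero]
  constructor
  · intro h
    calc X * t = t * tᴴ * X * t := by rw [hS.mul_star_self ht, Matrix.one_mul]
      _ = t * (tᴴ * X * t) := by simp only [Matrix.mul_assoc]
      _ = t * X := by rw [h]
  · intro h
    rw [Matrix.mul_assoc, h, ← Matrix.mul_assoc, hS.star_mul_self ht, Matrix.one_mul]

/-- Rank–nullity for an endomorphism with `ker ∩ im = 0`: `ker ⊔ im = ⊤`. [folklore] -/
theorem ker_sup_range_eq_top {V : Type*} [AddCommGroup V] [Module ℝ V] [FiniteDimensional ℝ V]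
    (f : V →ₗ[ℝ] V) (h : Disjoint (LinearMap.ker f) (LinearMap.range f)) :
    LinearMap.ker f ⊔ LinearMap.range f = ⊤ := by
  apply Submodule.eq_top_of_finrank_eq
  have h1 := Submodule.finrank_sup_add_finrank_inf_eq (LinearMap.ker f) (LinearMap.range f)
  rw [h.eq_bot, finrank_bot, add_zero, add_comm, LinearMap.finrank_range_add_finrank_ker] at h1
  exact h1

/-- **The decomposition `L(S) = 𝔷(t) + U_t L(S)`** for `t ∈ S`: every `w ∈ L(S)` is `k + U_t Z`
with `k` commuting with `t` and `Z ∈ L(S)`. [folklore] -/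
theorem exists_decomp_subAd (hS : IsClosedUnitaryGroup S) {t : Matrix ι ι ℂ} (ht : t ∈ S)
    {w : Matrix ι ι ℂ} (hw : w ∈ lieAlg hS) :
    ∃ k ∈ lieAlg hS, ∃ Z ∈ lieAlg hS, k * t = t * k ∧ w = k + subAd t Z := by
  set f : lieAlg hS →ₗ[ℝ] lieAlg hS := (subAd t).restrict fun X hX => subAd_mem_lieAlg hS ht hX
    with hf
  have hdis : Disjoint (LinearMap.ker f) (LinearMap.range f) := by
    rw [Submodule.disjoint_def]
    rintro v hv ⟨u, rfl⟩
    apply Subtype.ext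
    have h1 : subAd t (subAd t (u : Matrix ι ι ℂ)) = 0 := by
      have := congrArg Subtype.val hv
      simpa only [hf, LinearMap.coe_restrict_apply, ZeroMemClass.coe_zero] using this
    simpa only [hf, LinearMap.coe_restrict_apply, ZeroMemClass.coe_zero] using
      subAd_eq_zero_of_subAd_subAd_eq_zero (hS.mul_star_self ht) h1
  have hmem : (⟨w, hw⟩ : lieAlg hS) ∈ LinearMap.ker f ⊔ LinearMap.range f := by
    rw [ker_sup_range_eq_top f hdis]; exact Submodule.mem_top
  obtain ⟨k, hk, r, ⟨Z, rfl⟩, hkr⟩ := Submodule.mem_sup.1 hmem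
  refine ⟨k, k.2, Z, Z.2, ?_, ?_⟩
  · rw [← subAd_eq_zero_iff hS ht]
    have := congrArg Subtype.val hk
    simpa only [hf, LinearMap.coe_restrict_apply, ZeroMemClass.coe_zero] using this
  · have := congrArg Subtype.val hkr
    simpa only [hf, Submodule.coe_add, LinearMap.coe_restrict_apply] using this.symm

/-- The torus-like set `exp 𝔷(Y₀)` is commutative when `𝔷(Y₀)` is. [folklore] -/
theorem comm_exp_image {𝔱 : Submodule ℝ (Matrix ι ι ℂ)}
    (hcomm : ∀ X ∈ 𝔱, ∀ Y ∈ 𝔱, X * Y = Y * X) :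
    ∀ a ∈ exp '' (𝔱 : Set (Matrix ι ι ℂ)), ∀ b ∈ exp '' (𝔱 : Set (Matrix ι ι ℂ)), a * b = b * a := by
  rintro _ ⟨X, hX, rfl⟩ _ ⟨Y, hY, rfl⟩
  exact (Commute.exp (hcomm X hX Y hY) :)

/-- **`T = exp 𝔷(Y₀)` is closed** for a regular `Y₀`: its closure `Tc` is a connected abelian closed
unitary group whose Lie algebra is abelian and contained in `𝔷(Y₀)`, so `Tc = exp L(Tc) ⊆ T`.
[folklore] -/
theorem isClosed_exp_centralizer (hS : IsClosedUnitaryGroup S) {Y₀ : Matrix ι ι ℂ}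
    (hY₀ : Y₀ ∈ lieAlg hS)
    (hreg : ∀ X₁ ∈ centralizerL hS Y₀, ∀ X₂ ∈ centralizerL hS Y₀, X₁ * X₂ = X₂ * X₁) :
    IsClosed (exp '' (centralizerL hS Y₀ : Set (Matrix ι ι ℂ))) := by
  set 𝔱 := centralizerL hS Y₀ with h𝔱
  set T := exp '' (𝔱 : Set (Matrix ι ι ℂ)) with hT
  have h𝔱L : ∀ X ∈ 𝔱, X ∈ lieAlg hS := fun X hX => ((mem_centralizerL hS).1 hX).1
  have hY₀𝔱 : Y₀ ∈ 𝔱 := (mem_centralizerL hS).2 ⟨hY₀, by simp⟩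
  have hTcomm := comm_exp_image hreg
  -- the closure is a connected abelian closed unitary group
  have hTc : IsClosedUnitaryGroup (closure T) := by
    refine IsClosedUnitaryGroup.closure ⟨0, 𝔱.zero_mem, exp_zero⟩ ?_ ?_ ?_
    · rintro _ _ ⟨X, hX, rfl⟩ ⟨Y, hY, rfl⟩
      exact ⟨X + Y, 𝔱.add_mem hX hY, Matrix.exp_add_of_commute _ _ (hreg X hX Y hY)⟩
    · rintro _ ⟨X, hX, rfl⟩
      refine ⟨-X, 𝔱.neg_mem hX, ?_⟩
      rw [← Matrix.exp_conjTranspose, conjTranspose_eq_neg hS (h𝔱L X hX)]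
    · rintro _ ⟨X, hX, rfl⟩
      exact hS.mem_unitary (exp_mem_of_mem_lieSet (h𝔱L X hX))
  have hTconn : IsPreconnected (closure T) := by
    refine IsPreconnected.closure ?_
    have : T = Set.range fun X : 𝔱 => exp (X : Matrix ι ι ℂ) := by
      ext a; simp [hT]
    rw [this]
    exact isPreconnected_range (NormedSpace.exp_continuous.comp continuous_subtype_val)
  have hTS : closure T ⊆ S := by
    refine hS.isClosed.closure_subset_iff.2 ?_
    rintro _ ⟨X, hX, rfl⟩; exact exp_mem_of_mem_lieSet (h𝔱L X hX)
  -- its Lie algebra lies in `𝔱`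
  have hLTc : ∀ X ∈ lieAlg hTc, X ∈ 𝔱 := by
    intro X hX
    have hXS : X ∈ lieAlg hS := fun s => hTS (hX s)
    refine (mem_centralizerL hS).2 ⟨hXS, ?_⟩
    rw [adR_eq_zero_comm, adR_apply, sub_eq_zero]
    -- `exp (sX)` and `exp (u Y₀)` lie in the abelian `closure T`
    apply commute_of_forall_commute_exp
    intro u
    have hu : exp (u • Y₀) ∈ closure T := subset_closure ⟨u • Y₀, 𝔱.smul_mem u hY₀𝔱, rfl⟩
    symm
    apply commute_of_forall_commute_exp
    intro s
    exact commute_of_mem_closure hTcomm hu (hX s)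
  have hcommTc : ∀ X ∈ lieAlg hTc, ∀ Y ∈ lieAlg hTc, X * Y = Y * X :=
    fun X hX Y hY => hreg X (hLTc X hX) Y (hLTc Y hY)
  -- so `closure T = exp L(closure T) ⊆ T`
  have hsub : closure T ⊆ T := by
    rw [eq_exp_image_of_comm hTc hTconn hcommTc]
    rintro _ ⟨X, hX, rfl⟩
    exact ⟨X, hLTc X hX, rfl⟩
  exact closure_subset_iff_isClosed.1 hsub

/-- `exp X` for `X ∈ L(S)` is conjugate to an element of `T = exp 𝔷(Y₀)` (Hunt's lemma), and
conversely; so `exp L(S)` is the image of `S × T` under `(g, t) ↦ gᴴ t g`. [folklore] -/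
theorem exp_image_eq_conj_image (hS : IsClosedUnitaryGroup S) {Y₀ : Matrix ι ι ℂ}
    (hY₀ : Y₀ ∈ lieAlg hS) :
    exp '' (lieAlg hS : Set (Matrix ι ι ℂ)) =
      (fun p : Matrix ι ι ℂ × Matrix ι ι ℂ => p.1ᴴ * p.2 * p.1) ''
        (S ×ˢ (exp '' (centralizerL hS Y₀ : Set (Matrix ι ι ℂ)))) := by
  have key : ∀ g ∈ S, ∀ W : Matrix ι ι ℂ, gᴴ * exp W * g = exp (gᴴ * W * g) := fun g hg W => by
    have h := (Matrix.exp_conj gᴴ W (hS.isUnit (hS.star_mem hg))).symm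
    rwa [hS.inv_eq_star (hS.star_mem hg), conjTranspose_conjTranspose] at h
  apply Subset.antisymm
  · rintro _ ⟨X, hX, rfl⟩
    obtain ⟨g, hg, h⟩ := exists_adR_conj_eq_zero hS hX hY₀
    have hW : g * X * g⁻¹ ∈ centralizerL hS Y₀ :=
      (mem_centralizerL hS).2 ⟨conj_mem_lieAlg hS hg hX, adR_eq_zero_comm.1 h⟩
    refine ⟨(g, exp (g * X * g⁻¹)), ⟨hg, _, hW, rfl⟩, ?_⟩
    dsimp only
    rw [key g hg, hS.inv_eq_star hg]
    congr 1
    rw [show gᴴ * (g * X * gᴴ) * g = (gᴴ * g) * X * (gᴴ * g) by simp only [Matrix.mul_assoc],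
      hS.star_mul_self hg, Matrix.one_mul, Matrix.mul_one]
  · rintro _ ⟨⟨g, _⟩, ⟨hg, W, hW, rfl⟩, rfl⟩
    dsimp only
    rw [key g hg]
    refine ⟨_, ?_, rfl⟩
    have h := conj_mem_lieAlg hS (hS.star_mem hg) ((mem_centralizerL hS).1 hW).1
    rwa [hS.inv_eq_star (hS.star_mem hg), conjTranspose_conjTranspose] at h

/-- `exp L(S)` is compact (hence closed), being a continuous image of `S × T`. [folklore] -/
theorem isCompact_exp_image (hS : IsClosedUnitaryGroup S) :
    IsCompact (exp '' (lieAlg hS : Set (Matrix ι ι ℂ))) := by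
  obtain ⟨Y₀, hY₀, hreg⟩ := exists_isRegular hS
  rw [exp_image_eq_conj_image hS hY₀]
  refine (hS.isCompact.prod ?_).image (by fun_prop)
  refine (hS.isCompact.of_isClosed_subset (isClosed_exp_centralizer hS hY₀ hreg) ?_)
  rintro _ ⟨X, hX, rfl⟩
  exact exp_mem_of_mem_lieSet ((mem_centralizerL hS).1 hX).1

/-- `exp L(S)` is invariant under conjugation by `S`. [folklore] -/
theorem conj_mem_exp_image (hS : IsClosedUnitaryGroup S) {g e : Matrix ι ι ℂ} (hg : g ∈ S)
    (he : e ∈ exp '' (lieAlg hS : Set (Matrix ι ι ℂ))) :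
    g * e * g⁻¹ ∈ exp '' (lieAlg hS : Set (Matrix ι ι ℂ)) := by
  obtain ⟨X, hX, rfl⟩ := he
  exact ⟨g * X * g⁻¹, conj_mem_lieAlg hS hg hX, Matrix.exp_conj _ _ (hS.isUnit hg)⟩

end ExpPrep


/-! ### The submersion lemma -/

section Submersion

variable {S : Set (Matrix ι ι ℂ)}

/-- **Submersion lemma.** Let `t ∈ S` and let `E ⊆ S` be invariant under conjugation by `S` and
contain `t · exp Y` for every `Y ∈ 𝔷(t) = {Y ∈ L(S) | Yt = tY}`. Then `E` is a neighbourhood of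
`t` in `S`: the map `(Z, Y) ↦ exp Z · t exp Y · exp (-Z)` from `L(S) × 𝔷(t)` into `E`, read in
the logarithmic chart at `t`, has surjective differential `(Z, Y) ↦ Ad(t⁻¹)Z - Z + Y` at `0`
because `L(S) = 𝔷(t) + (Ad(t⁻¹) - 1) L(S)`; so it covers a neighbourhood (open mapping). [folklore] -/
theorem exists_nhds_subset_of_conj_invariant (hS : IsClosedUnitaryGroup S) {t : Matrix ι ι ℂ}
    (ht : t ∈ S) {E : Set (Matrix ι ι ℂ)} (hES : E ⊆ S)
    (hEconj : ∀ g ∈ S, ∀ e ∈ E, g * e * g⁻¹ ∈ E)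
    (hE : ∀ Y ∈ centralizerL hS t, t * exp Y ∈ E) :
    ∃ δ > 0, ∀ y ∈ S, dist y t < δ → y ∈ E := by
  set L := lieAlg hS with hL
  set 𝔥 := centralizerL hS t with h𝔥
  -- a continuous linear projection onto `L`
  obtain ⟨Q, hLQ⟩ := L.exists_isCompl
  set P : Matrix ι ι ℂ →L[ℝ] L := LinearMap.toContinuousLinearMap (L.projectionOnto Q hLQ) with hP_def
  have hP : ∀ x (hx : x ∈ L), P x = ⟨x, hx⟩ := fun x hx =>
    Submodule.projectionOnto_apply_of_mem_left hLQ hx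
  -- the maps
  set Φ : L × 𝔥 → Matrix ι ι ℂ := fun q =>
    exp (q.1 : Matrix ι ι ℂ) * (t * exp (q.2 : Matrix ι ι ℂ)) * exp (-(q.1 : Matrix ι ι ℂ))
    with hΦ_def
  set Ψ : L × 𝔥 → L := fun q => P (mlog (tᴴ * Φ q)) with hΨ_def
  have hΦE : ∀ q, Φ q ∈ E := fun q => by
    have h := hEconj _ (exp_mem_of_mem_lieSet q.1.2) _ (hE _ q.2.2)
    rwa [← Matrix.exp_neg] at h
  have hΦ0 : Φ 0 = t := by
    simp only [hΦ_def, Prod.fst_zero, Prod.snd_zero, ZeroMemClass.coe_zero, neg_zero, exp_zero,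
      Matrix.one_mul, Matrix.mul_one]
  have hm0 : tᴴ * Φ 0 = 1 := by rw [hΦ0, hS.star_mul_self ht]
  -- the expected derivative of `Φ` at `0`
  set D₀ₗ : L × 𝔥 →ₗ[ℝ] Matrix ι ι ℂ :=
    { toFun := fun q => (q.1 : Matrix ι ι ℂ) * t - t * q.1 + t * q.2
      map_add' := fun a b => by
        simp only [Prod.fst_add, Prod.snd_add, Submodule.coe_add, Matrix.add_mul, Matrix.mul_add]
        abel
      map_smul' := fun c a => by
        simp only [Prod.smul_fst, Prod.smul_snd, Submodule.coe_smul, Matrix.smul_mul,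
          Matrix.mul_smul, smul_sub, smul_add, RingHom.id_apply] } with hD₀ₗ
  set D₀ : L × 𝔥 →L[ℝ] Matrix ι ι ℂ := LinearMap.toContinuousLinearMap D₀ₗ with hD₀
  have hD₀_apply : ∀ q : L × 𝔥, D₀ q = (q.1 : Matrix ι ι ℂ) * t - t * q.1 + t * q.2 := fun q => rfl
  -- `Φ` has derivative `D₀` at `0`
  have hΦ : HasStrictFDerivAt Φ D₀ 0 := by
    have hA : HasStrictFDerivAt (fun q : L × 𝔥 => exp (q.1 : Matrix ι ι ℂ))
        (L.subtypeL.comp (ContinuousLinearMap.fst ℝ L 𝔥)) 0 := by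
      have hl := (L.subtypeL.comp (ContinuousLinearMap.fst ℝ L 𝔥)).hasStrictFDerivAt (x := 0)
      have h0 : HasStrictFDerivAt (exp : Matrix ι ι ℂ → Matrix ι ι ℂ)
          (1 : Matrix ι ι ℂ →L[ℝ] Matrix ι ι ℂ) ((L.subtypeL.comp (ContinuousLinearMap.fst ℝ L 𝔥)) 0) := by
        rw [map_zero]
        exact hasStrictFDerivAt_exp_zero (𝕂 := ℝ) (𝔸 := Matrix ι ι ℂ)
      exact (h0.comp 0 hl).congr_fderiv (by
        rw [ContinuousLinearMap.one_def]; exact ContinuousLinearMap.id_comp _)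
    have hB : HasStrictFDerivAt (fun q : L × 𝔥 => t * exp (q.2 : Matrix ι ι ℂ))
        (t • 𝔥.subtypeL.comp (ContinuousLinearMap.snd ℝ L 𝔥)) 0 := by
      have hl := (𝔥.subtypeL.comp (ContinuousLinearMap.snd ℝ L 𝔥)).hasStrictFDerivAt (x := 0)
      have h0 : HasStrictFDerivAt (exp : Matrix ι ι ℂ → Matrix ι ι ℂ)
          (1 : Matrix ι ι ℂ →L[ℝ] Matrix ι ι ℂ) ((𝔥.subtypeL.comp (ContinuousLinearMap.snd ℝ L 𝔥)) 0) := by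
        rw [map_zero]
        exact hasStrictFDerivAt_exp_zero (𝕂 := ℝ) (𝔸 := Matrix ι ι ℂ)
      have h1 : HasStrictFDerivAt (fun q : L × 𝔥 => exp (q.2 : Matrix ι ι ℂ))
          (𝔥.subtypeL.comp (ContinuousLinearMap.snd ℝ L 𝔥)) 0 :=
        (h0.comp 0 hl).congr_fderiv (by
          rw [ContinuousLinearMap.one_def]; exact ContinuousLinearMap.id_comp _)
      exact h1.const_mul t
    have hC : HasStrictFDerivAt (fun q : L × 𝔥 => exp (-(q.1 : Matrix ι ι ℂ)))
        (-(L.subtypeL.comp (ContinuousLinearMap.fst ℝ L 𝔥))) 0 := by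
      have hl := (-(L.subtypeL.comp (ContinuousLinearMap.fst ℝ L 𝔥))).hasStrictFDerivAt (x := 0)
      have h0 : HasStrictFDerivAt (exp : Matrix ι ι ℂ → Matrix ι ι ℂ)
          (1 : Matrix ι ι ℂ →L[ℝ] Matrix ι ι ℂ) ((-(L.subtypeL.comp (ContinuousLinearMap.fst ℝ L 𝔥))) 0) := by
        rw [map_zero]
        exact hasStrictFDerivAt_exp_zero (𝕂 := ℝ) (𝔸 := Matrix ι ι ℂ)
      exact (h0.comp 0 hl).congr_fderiv (by
        rw [ContinuousLinearMap.one_def]; exact ContinuousLinearMap.id_comp _)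
    refine ((hA.mul' hB).mul' hC).congr_fderiv ?_
    refine ContinuousLinearMap.ext fun q => ?_
    change (exp (((0 : L × 𝔥).1 : L) : Matrix ι ι ℂ) * (t * exp (((0 : L × 𝔥).2 : 𝔥) : Matrix ι ι ℂ)))
        * (-(q.1 : Matrix ι ι ℂ)) +
        (exp (((0 : L × 𝔥).1 : L) : Matrix ι ι ℂ) * (t * (q.2 : Matrix ι ι ℂ)) +
          (q.1 : Matrix ι ι ℂ) * (t * exp (((0 : L × 𝔥).2 : 𝔥) : Matrix ι ι ℂ))) *
          exp (-(((0 : L × 𝔥).1 : L) : Matrix ι ι ℂ)) =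
      (q.1 : Matrix ι ι ℂ) * t - t * q.1 + t * q.2
    simp only [Prod.fst_zero, Prod.snd_zero, ZeroMemClass.coe_zero, neg_zero, exp_zero,
      Matrix.one_mul, Matrix.mul_one, Matrix.mul_neg]
    abel
  -- the chart map `Ψ`
  have hm : HasStrictFDerivAt (fun q => tᴴ * Φ q) (tᴴ • D₀) 0 := hΦ.const_mul tᴴ
  have hlog : HasStrictFDerivAt mlog (1 : Matrix ι ι ℂ →L[ℝ] Matrix ι ι ℂ) (tᴴ * Φ 0) := by
    rw [hm0]; exact hasStrictFDerivAt_mlog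
  have hΨ : HasStrictFDerivAt Ψ (P.comp ((1 : Matrix ι ι ℂ →L[ℝ] Matrix ι ι ℂ).comp (tᴴ • D₀))) 0 :=
    P.hasStrictFDerivAt.comp 0 (hlog.comp 0 hm)
  have hΨ0 : Ψ 0 = 0 := by
    simp only [hΨ_def, hm0, mlog_one, map_zero]
  -- its differential is onto: `L = 𝔷(t) + U_t L`
  have hsurj : (P.comp ((1 : Matrix ι ι ℂ →L[ℝ] Matrix ι ι ℂ).comp (tᴴ • D₀))).range = ⊤ := by
    refine LinearMap.range_eq_top.2 fun w => ?_
    obtain ⟨k, hk, Z, hZ, hkt, hw⟩ := exists_decomp_subAd hS ht w.2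
    have hk𝔥 : k ∈ 𝔥 := (mem_centralizerL hS).2 ⟨hk, by rw [adR_apply, sub_eq_zero]; exact hkt.symm⟩
    refine ⟨(⟨Z, hZ⟩, ⟨k, hk𝔥⟩), ?_⟩
    have hval : tᴴ * ((Z : Matrix ι ι ℂ) * t - t * Z + t * k) = (w : Matrix ι ι ℂ) := by
      rw [hw, subAd_apply]
      simp only [Matrix.mul_add, Matrix.mul_sub, ← Matrix.mul_assoc, hS.star_mul_self ht,
        Matrix.one_mul]
      abel
    change P (tᴴ * ((Z : Matrix ι ι ℂ) * t - t * Z + t * k)) = w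
    rw [hval, hP w w.2]
  have hmap := hΨ.map_nhds_eq_of_surj hsurj
  rw [hΨ0] at hmap
  -- `V = {X ∈ L | t exp X ∈ E}` is a neighbourhood of `0` in `L`
  obtain ⟨ε, hε, hchart⟩ := exists_chart hS
  have hmS : ∀ q, tᴴ * Φ q ∈ S := fun q => hS.mul_mem (hS.star_mem ht) (hES (hΦE q))
  have hm1 : Tendsto (fun q => tᴴ * Φ q) (𝓝 0) (𝓝 1) := by
    have h := hm.continuousAt.tendsto
    rw [hm0] at h
    exact h
  have hV : {X : L | t * exp (X : Matrix ι ι ℂ) ∈ E} ∈ 𝓝 (0 : L) := by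
    refine hmap.ge (Filter.mem_map.2 ?_)
    filter_upwards [hm1.eventually (Metric.ball_mem_nhds 1 hε)] with q hq
    have hc := hchart _ (hmS q) hq
    change t * exp ((P (mlog (tᴴ * Φ q)) : Matrix ι ι ℂ)) ∈ E
    rw [hP _ hc.1]
    dsimp only
    rw [hc.2, ← Matrix.mul_assoc, hS.mul_star_self ht, Matrix.one_mul]
    exact hΦE q
  -- pull back to a neighbourhood of `t` in `S`
  obtain ⟨U, hU, hUV⟩ := (mem_nhds_subtype _ _ _).1 hV
  obtain ⟨ε', hε', hnhd⟩ := exists_nhds_subset_exp_image_of_mem_nhds hS hU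
  have hcont : ContinuousAt (fun y : Matrix ι ι ℂ => tᴴ * y) t := by fun_prop
  obtain ⟨δ, hδ, hball⟩ := Metric.continuousAt_iff.1 hcont ε' hε'
  refine ⟨δ, hδ, fun y hy hyt => ?_⟩
  have h1 : dist (tᴴ * y) 1 < ε' := by
    have := hball hyt
    rwa [hS.star_mul_self ht] at this
  obtain ⟨X, hXL, hXU, hXy⟩ := hnhd _ (hS.mul_mem (hS.star_mem ht) hy) h1
  have h2 : (⟨X, hXL⟩ : L) ∈ {X : L | t * exp (X : Matrix ι ι ℂ) ∈ E} := hUV hXU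
  have h3 : t * exp X ∈ E := h2
  rwa [hXy, ← Matrix.mul_assoc, hS.mul_star_self ht, Matrix.one_mul] at h3

end Submersion


/-! ### Surjectivity of the exponential map for compact connected unitary matrix groups -/

section ExpSurjective

variable {S : Set (Matrix ι ι ℂ)}

/-- `gᴴ exp(W) g = exp (gᴴ W g)` for `g ∈ S`. [folklore] -/
theorem star_mul_exp_mul (hS : IsClosedUnitaryGroup S) {g : Matrix ι ι ℂ} (hg : g ∈ S)
    (W : Matrix ι ι ℂ) : gᴴ * exp W * g = exp (gᴴ * W * g) := by
  have h := (Matrix.exp_conj gᴴ W (hS.isUnit (hS.star_mem hg))).symm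
  rwa [hS.inv_eq_star (hS.star_mem hg), conjTranspose_conjTranspose] at h

/-- The central case of the openness argument: if `t = exp W₀`, `W₀ ∈ 𝔷(Y₀)`, is central in
the connected `S`, then `exp L(S)` is a neighbourhood of `t` in `S` (`t exp X = gᴴ exp (W₀ + W) g`
when `Ad(g) X = W ∈ 𝔷(Y₀)`). [folklore] -/
theorem exists_nhds_subset_exp_image_of_central (hS : IsClosedUnitaryGroup S) {Y₀ W₀ : Matrix ι ι ℂ}
    (hY₀ : Y₀ ∈ lieAlg hS)
    (hreg : ∀ X₁ ∈ centralizerL hS Y₀, ∀ X₂ ∈ centralizerL hS Y₀, X₁ * X₂ = X₂ * X₁)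
    (hW₀ : W₀ ∈ centralizerL hS Y₀) (hcentral : ∀ g ∈ S, g * exp W₀ = exp W₀ * g) :
    ∃ δ > 0, ∀ y ∈ S, dist y (exp W₀) < δ → y ∈ exp '' (lieAlg hS : Set (Matrix ι ι ℂ)) := by
  have h𝔱L : ∀ X ∈ centralizerL hS Y₀, X ∈ lieAlg hS := fun X hX => ((mem_centralizerL hS).1 hX).1
  have ht : exp W₀ ∈ S := exp_mem_of_mem_lieSet (h𝔱L W₀ hW₀)
  obtain ⟨ε, hε, hnhd⟩ := exists_nhds_subset_exp_image hS
  have hcont : ContinuousAt (fun y : Matrix ι ι ℂ => (exp W₀)ᴴ * y) (exp W₀) := by fun_prop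
  obtain ⟨δ, hδ, hball⟩ := Metric.continuousAt_iff.1 hcont ε hε
  refine ⟨δ, hδ, fun y hy hyt => ?_⟩
  have h1 : dist ((exp W₀)ᴴ * y) 1 < ε := by
    have := hball hyt
    rwa [hS.star_mul_self ht] at this
  obtain ⟨X, hX, hXy⟩ := hnhd _ (hS.mul_mem (hS.star_mem ht) hy) h1
  obtain ⟨g, hg, h⟩ := exists_adR_conj_eq_zero hS hX hY₀
  have hW : g * X * g⁻¹ ∈ centralizerL hS Y₀ :=
    (mem_centralizerL hS).2 ⟨conj_mem_lieAlg hS hg hX, adR_eq_zero_comm.1 h⟩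
  -- `y = exp W₀ · exp X = gᴴ exp (W₀ + W) g`
  have hX' : X = gᴴ * (g * X * g⁻¹) * g := by
    rw [hS.inv_eq_star hg, show gᴴ * (g * X * gᴴ) * g = (gᴴ * g) * X * (gᴴ * g) by
      simp only [Matrix.mul_assoc], hS.star_mul_self hg, Matrix.one_mul, Matrix.mul_one]
  have hy' : y = exp W₀ * exp X := by
    rw [hXy, ← Matrix.mul_assoc, hS.mul_star_self ht, Matrix.one_mul]
  refine ⟨gᴴ * (W₀ + g * X * g⁻¹) * g, ?_, ?_⟩
  · have := conj_mem_lieAlg hS (hS.star_mem hg)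
      ((lieAlg hS).add_mem (h𝔱L W₀ hW₀) (h𝔱L _ hW))
    rwa [hS.inv_eq_star (hS.star_mem hg), conjTranspose_conjTranspose] at this
  · have hXW : exp X = gᴴ * exp (g * X * g⁻¹) * g := by rw [star_mul_exp_mul hS hg, ← hX']
    have hc := hcentral g hg
    rw [hy', hXW, ← star_mul_exp_mul hS hg, Matrix.exp_add_of_commute _ _ (hreg _ hW₀ _ hW)]
    calc gᴴ * (exp W₀ * exp (g * X * g⁻¹)) * g
        = gᴴ * (exp W₀ * g) * (gᴴ * exp (g * X * g⁻¹) * g) := by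
          rw [show gᴴ * (exp W₀ * g) * (gᴴ * exp (g * X * g⁻¹) * g) =
            gᴴ * exp W₀ * (g * gᴴ) * exp (g * X * g⁻¹) * g by simp only [Matrix.mul_assoc],
            hS.mul_star_self hg, Matrix.mul_one]
          simp only [Matrix.mul_assoc]
      _ = exp W₀ * (gᴴ * exp (g * X * g⁻¹) * g) := by
          rw [← hc, ← Matrix.mul_assoc gᴴ g, hS.star_mul_self hg, Matrix.one_mul]

/-- **The exponential map of a compact connected unitary matrix group is surjective**
(`S = exp L(S)`; Bröcker–tom Dieck IV (2.2), there deduced from the main theorem on maximal tori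
IV (1.6)). Here by strong induction on `dim L(S)`: `E = exp L(S) = ⋃_g g T gᴴ` is compact, and it
is open in `S` — near `t ∈ T`, if `t` is central then `t · exp L(S) ⊆ E` by Hunt's lemma, and
otherwise the identity component `H` of the centraliser of `t` has smaller dimension, so
`H = exp L(H) ⊆ E` by induction and the submersion lemma applies; connectedness of `S` concludes.
[cite: BrockerTomDieck1985, IV (2.2)] -/
theorem subset_exp_image_of_finrank_eq : ∀ (n : ℕ) {S : Set (Matrix ι ι ℂ)}
    (hS : IsClosedUnitaryGroup S), IsPreconnected S → Module.finrank ℝ (lieAlg hS) = n →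
    S ⊆ exp '' (lieAlg hS : Set (Matrix ι ι ℂ)) := by
  intro n
  induction n using Nat.strong_induction_on with
  | _ n ih => ?_
  intro S hS hconn hn
  obtain ⟨Y₀, hY₀, hreg⟩ := exists_isRegular hS
  have h𝔱L : ∀ X ∈ centralizerL hS Y₀, X ∈ lieAlg hS := fun X hX => ((mem_centralizerL hS).1 hX).1
  set E := exp '' (lieAlg hS : Set (Matrix ι ι ℂ)) with hE_def
  have hES : E ⊆ S := by rintro _ ⟨X, hX, rfl⟩; exact exp_mem_of_mem_lieSet hX
  have hEconj : ∀ g ∈ S, ∀ e ∈ E, g * e * g⁻¹ ∈ E := fun g hg e he => conj_mem_exp_image hS hg he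
  have hEclosed : IsClosed E := (isCompact_exp_image hS).isClosed
  -- `E` is open in `S`: first near points of `T = exp 𝔷(Y₀)`
  have hT : ∀ W₀ ∈ centralizerL hS Y₀, ∃ δ > 0, ∀ y ∈ S, dist y (exp W₀) < δ → y ∈ E := by
    intro W₀ hW₀
    have ht : exp W₀ ∈ S := exp_mem_of_mem_lieSet (h𝔱L W₀ hW₀)
    by_cases hcase : lieAlg hS ≤ LinearMap.ker (adR (exp W₀))
    · -- `t` is central
      refine exists_nhds_subset_exp_image_of_central hS hY₀ hreg hW₀ ?_
      refine central_of_forall_commute_exp hS hconn fun X hX => ?_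
      have h := hcase hX
      rw [LinearMap.mem_ker, adR_apply, sub_eq_zero] at h
      exact (Commute.exp_right h :)
    · -- the centraliser of `t` is a proper subgroup: induction
      have hlt : centralizerL hS (exp W₀) < lieAlg hS :=
        lt_of_le_of_ne inf_le_left fun h => hcase (by rw [← h]; exact inf_le_right)
      have hfin : Module.finrank ℝ (centralizerL hS (exp W₀)) < n :=
        hn ▸ Submodule.finrank_lt_finrank_of_lt hlt
      have hZ := hS.centralizer (exp W₀)
      have hH := hZ.identityComponent
      have hHS : connectedComponentIn {g ∈ S | g * exp W₀ = exp W₀ * g} 1 ⊆ S :=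
        fun g hg => (connectedComponentIn_subset _ _ hg).1
      -- `L(H) = 𝔷(t)`
      have hLH : lieAlg hH = centralizerL hS (exp W₀) := by
        ext X
        constructor
        · intro hX
          refine (mem_centralizerL hS).2 ⟨fun s => hHS (hX s), ?_⟩
          rw [adR_apply, sub_eq_zero]
          exact commute_of_forall_commute_exp fun s =>
            ((connectedComponentIn_subset _ _ (hX s)).2).symm
        · intro hX
          rw [mem_centralizerL, adR_apply, sub_eq_zero] at hX
          intro s
          exact curve_subset_identityComponent (γ := fun s : ℝ => exp (s • X))
            (S := {g ∈ S | g * exp W₀ = exp W₀ * g})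
            (NormedSpace.exp_continuous.comp (continuous_id.smul continuous_const))
            (by simp) (fun s => ⟨hX.1 s,
              (Commute.exp_left ((show Commute X (exp W₀) from hX.2.symm).smul_left s) :)⟩) s
      have hIH := ih _ (by rw [hLH]; exact hfin) hH isPreconnected_connectedComponentIn rfl
      -- `t ∈ H`
      have htH : exp W₀ ∈ connectedComponentIn {g ∈ S | g * exp W₀ = exp W₀ * g} 1 := by
        have h := curve_subset_identityComponent (γ := fun s : ℝ => exp (s • W₀))
          (S := {g ∈ S | g * exp W₀ = exp W₀ * g})
          (NormedSpace.exp_continuous.comp (continuous_id.smul continuous_const)) (by simp)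
          (fun s => ⟨(h𝔱L W₀ hW₀) s, (((Commute.refl W₀).smul_left s).exp :)⟩) 1
        rwa [one_smul] at h
      -- the submersion lemma
      refine exists_nhds_subset_of_conj_invariant hS ht hES hEconj fun Y hY => ?_
      have hY' : Y ∈ lieAlg hH := by rw [hLH]; exact hY
      have hmem : exp W₀ * exp Y ∈ connectedComponentIn {g ∈ S | g * exp W₀ = exp W₀ * g} 1 :=
        hH.mul_mem htH (exp_mem_of_mem_lieSet hY')
      obtain ⟨X, hX, hXe⟩ := hIH hmem
      exact ⟨X, fun s => hHS (hX s), hXe⟩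
  -- then near every point of `E`, by conjugation
  have hopen : ∀ x ∈ E, ∃ δ > 0, ∀ y ∈ S, dist y x < δ → y ∈ E := by
    intro x hx
    rw [hE_def, exp_image_eq_conj_image hS hY₀] at hx
    obtain ⟨⟨g, _⟩, ⟨hg, W₀, hW₀, rfl⟩, rfl⟩ := hx
    obtain ⟨δ, hδ, hball⟩ := hT W₀ hW₀
    have hcont : ContinuousAt (fun y : Matrix ι ι ℂ => g * y * gᴴ) (gᴴ * exp W₀ * g) := by
      fun_prop
    have hval : g * (gᴴ * exp W₀ * g) * gᴴ = exp W₀ := by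
      rw [show g * (gᴴ * exp W₀ * g) * gᴴ = (g * gᴴ) * exp W₀ * (g * gᴴ) by
        simp only [Matrix.mul_assoc], hS.mul_star_self hg, Matrix.one_mul, Matrix.mul_one]
    obtain ⟨δ', hδ', hball'⟩ := Metric.continuousAt_iff.1 hcont δ hδ
    refine ⟨δ', hδ', fun y hy hyd => ?_⟩
    have h1 : dist (g * y * gᴴ) (exp W₀) < δ := by
      have := hball' hyd
      rwa [hval] at this
    have h2 : g * y * gᴴ ∈ E := hball _ (hS.mul_mem (hS.mul_mem hg hy) (hS.star_mem hg)) h1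
    have h3 := hEconj gᴴ (hS.star_mem hg) _ h2
    rwa [hS.inv_eq_star (hS.star_mem hg), conjTranspose_conjTranspose,
      show gᴴ * (g * y * gᴴ) * g = (gᴴ * g) * y * (gᴴ * g) by simp only [Matrix.mul_assoc],
      hS.star_mul_self hg, Matrix.one_mul, Matrix.mul_one] at h3
  -- connectedness
  by_contra hnot
  obtain ⟨x, hxS, hxE⟩ := Set.not_subset.1 hnot
  choose δ hδ hball using hopen
  set u : Set (Matrix ι ι ℂ) := ⋃ (e : Matrix ι ι ℂ) (he : e ∈ E), Metric.ball e (δ e he) with hu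
  have huo : IsOpen u := isOpen_iUnion fun e => isOpen_iUnion fun _ => Metric.isOpen_ball
  have hSuv : S ⊆ u ∪ Eᶜ := fun y hy => by
    by_cases hyE : y ∈ E
    · exact Or.inl (Set.mem_iUnion₂.2 ⟨y, hyE, Metric.mem_ball_self (hδ y hyE)⟩)
    · exact Or.inr hyE
  obtain ⟨y, hyS, hyu, hyv⟩ := hconn u Eᶜ huo hEclosed.isOpen_compl hSuv
    ⟨1, hS.one_mem, Set.mem_iUnion₂.2 ⟨1, ⟨0, (lieAlg hS).zero_mem, exp_zero⟩,
      Metric.mem_ball_self (hδ _ _)⟩⟩ ⟨x, hxS, hxE⟩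
  obtain ⟨e, he, hye⟩ := Set.mem_iUnion₂.1 hyu
  exact hyv (hball e he y hyS hye)

/-- `S = exp L(S)` for a connected closed unitary matrix group. [cite: BrockerTomDieck1985, IV (2.2)] -/
theorem eq_exp_image (hS : IsClosedUnitaryGroup S) (hconn : IsPreconnected S) :
    S = exp '' (lieAlg hS : Set (Matrix ι ι ℂ)) := by
  refine Subset.antisymm (subset_exp_image_of_finrank_eq _ hS hconn rfl) ?_
  rintro _ ⟨X, hX, rfl⟩; exact exp_mem_of_mem_lieSet hX

/-- Every element of a connected closed unitary matrix group is an exponential.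
[cite: BrockerTomDieck1985, IV (2.2)] -/
theorem exists_exp_eq (hS : IsClosedUnitaryGroup S) (hconn : IsPreconnected S) {g : Matrix ι ι ℂ}
    (hg : g ∈ S) : ∃ X ∈ lieAlg hS, exp X = g := by
  have h := subset_exp_image_of_finrank_eq _ hS hconn rfl hg
  exact h

/-- **Every element lies in the identity component of its own centraliser** (connected `S`).
[folklore] -/
theorem mem_identityComponent_centralizer (hS : IsClosedUnitaryGroup S) (hconn : IsPreconnected S)
    {z : Matrix ι ι ℂ} (hz : z ∈ S) : z ∈ connectedComponentIn {g ∈ S | g * z = z * g} 1 := by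
  obtain ⟨X, hX, rfl⟩ := exists_exp_eq hS hconn hz
  have h := curve_subset_identityComponent (γ := fun s : ℝ => exp (s • X))
    (S := {g ∈ S | g * exp X = exp X * g})
    (NormedSpace.exp_continuous.comp (continuous_id.smul continuous_const)) (by simp)
    (fun s => ⟨hX s, (((Commute.refl X).smul_left s).exp :)⟩) 1
  rwa [one_smul] at h

end ExpSurjective

/-! ### An element with abelian centraliser -/

section Main

variable {S : Set (Matrix ι ι ℂ)}

/-- **Main theorem (matrix form).** A compact connected group of unitary matrices contains an
element `g₀` whose centraliser is abelian: `g₀ = exp (s Y₀)` for a regular `Y₀ ∈ L(S)` and small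
`s > 0`. Indeed if `z` commutes with `g₀` then `Ad(z) Y₀ = Y₀` (injectivity of `exp` near `0`);
`z` lies in the identity component `K` of its own centraliser, `Y₀ ∈ L(K)`, and `z` is central in
`K`, so writing `z = exp X'` (surjectivity of `exp` on `K`) Hunt's lemma in `K` gives `z = exp W`
with `[W, Y₀] = 0`; all such `W` lie in the abelian `𝔷(Y₀)`, so the centraliser of `g₀` is
abelian. (Bröcker–tom Dieck IV (2.3)(i): `Z(T) = T` for the maximal torus `T = exp 𝔷(Y₀)`; a
generator `g₀` of `T` has `Z(g₀) = T`.) [cite: BrockerTomDieck1985, IV (2.3)(i)] -/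
theorem exists_abelian_centralizer (hS : IsClosedUnitaryGroup S) (hconn : IsPreconnected S) :
    ∃ g₀ ∈ S, ∀ a ∈ S, ∀ b ∈ S, a * g₀ = g₀ * a → b * g₀ = g₀ * b → a * b = b * a := by
  obtain ⟨Y₀, hY₀, hreg⟩ := exists_isRegular hS
  have h𝔱L : ∀ X ∈ centralizerL hS Y₀, X ∈ lieAlg hS := fun X hX => ((mem_centralizerL hS).1 hX).1
  -- injectivity radius of `exp` and a bound for `Ad(S) Y₀`
  obtain ⟨r, hr, hinj⟩ := exists_ball_injOn_exp (ι := ι)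
  obtain ⟨C, hC⟩ := hS.isCompact.exists_bound_of_continuousOn
    (f := fun z : Matrix ι ι ℂ => z * Y₀ * zᴴ) (by fun_prop)
  set B := max C ‖Y₀‖ + 1 with hB
  have hBpos : 0 < B := by
    have : (0 : ℝ) ≤ max C ‖Y₀‖ := le_max_of_le_right (norm_nonneg _)
    linarith
  have hCB : C ≤ B := by linarith [le_max_left C ‖Y₀‖]
  have hYB : ‖Y₀‖ ≤ B := by linarith [le_max_right C ‖Y₀‖]
  set s := r / (2 * B) with hs
  have hspos : 0 < s := by positivity
  have hsB : s * B < r := by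
    have : s * B = r / 2 := by rw [hs]; field_simp
    rw [this]; linarith
  set g₀ := exp (s • Y₀) with hg₀
  have hg₀S : g₀ ∈ S := hY₀ s
  -- elements commuting with `g₀` commute with `Y₀` …
  have hcommY : ∀ z ∈ S, z * g₀ = g₀ * z → z * Y₀ = Y₀ * z := by
    intro z hz hzg
    have e1 : exp (s • (z * Y₀ * zᴴ)) = exp (s • Y₀) := by
      rw [show s • (z * Y₀ * zᴴ) = z * (s • Y₀) * z⁻¹ by
        rw [hS.inv_eq_star hz, Matrix.mul_smul, Matrix.smul_mul], Matrix.exp_conj _ _ (hS.isUnit hz),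
        ← hg₀, hzg, Matrix.mul_assoc, hS.inv_eq_star hz, hS.mul_star_self hz, Matrix.mul_one]
    have hb1 : s • (z * Y₀ * zᴴ) ∈ Metric.ball (0 : Matrix ι ι ℂ) r := by
      rw [Metric.mem_ball, dist_zero_right, norm_smul, Real.norm_of_nonneg hspos.le]
      calc s * ‖z * Y₀ * zᴴ‖ ≤ s * B :=
            mul_le_mul_of_nonneg_left ((hC z hz).trans hCB) hspos.le
        _ < r := hsB
    have hb2 : s • Y₀ ∈ Metric.ball (0 : Matrix ι ι ℂ) r := by
      rw [Metric.mem_ball, dist_zero_right, norm_smul, Real.norm_of_nonneg hspos.le]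
      calc s * ‖Y₀‖ ≤ s * B := mul_le_mul_of_nonneg_left hYB hspos.le
        _ < r := hsB
    have e2 : z * Y₀ * zᴴ = Y₀ := smul_right_injective _ hspos.ne' (hinj hb1 hb2 e1)
    calc z * Y₀ = z * Y₀ * (zᴴ * z) := by rw [hS.star_mul_self hz, Matrix.mul_one]
      _ = (z * Y₀ * zᴴ) * z := by simp only [Matrix.mul_assoc]
      _ = Y₀ * z := by rw [e2]
  -- … and are exponentials of elements of `𝔷(Y₀)`
  have hexp : ∀ z ∈ S, z * g₀ = g₀ * z → ∃ W ∈ centralizerL hS Y₀, exp W = z := by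
    intro z hz hzg
    have hzY := hcommY z hz hzg
    have hK := (hS.centralizer z).identityComponent
    have hKS : connectedComponentIn {g ∈ S | g * z = z * g} 1 ⊆ S :=
      fun g hg => (connectedComponentIn_subset _ _ hg).1
    have hzK := mem_identityComponent_centralizer hS hconn hz
    have hY₀K : Y₀ ∈ lieAlg hK := fun u =>
      curve_subset_identityComponent (γ := fun u : ℝ => exp (u • Y₀)) (S := {g ∈ S | g * z = z * g})
        (NormedSpace.exp_continuous.comp (continuous_id.smul continuous_const)) (by simp)
        (fun u => ⟨hY₀ u, (Commute.exp_left ((show Commute Y₀ z from hzY.symm).smul_left u) :)⟩) u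
    obtain ⟨X', hX', hzX'⟩ := exists_exp_eq hK isPreconnected_connectedComponentIn hzK
    obtain ⟨k, hk, hkad⟩ := exists_adR_conj_eq_zero hK hX' hY₀K
    have hkz : k * z = z * k := (connectedComponentIn_subset _ _ hk).2
    refine ⟨k * X' * k⁻¹, (mem_centralizerL hS).2 ⟨fun u => hKS (conj_mem_lieAlg hK hk hX' u),
      adR_eq_zero_comm.1 hkad⟩, ?_⟩
    rw [Matrix.exp_conj _ _ (hK.isUnit hk), hzX', hkz, Matrix.mul_assoc, hK.inv_eq_star hk,
      hK.mul_star_self hk, Matrix.mul_one]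
  refine ⟨g₀, hg₀S, fun a ha b hb hag hbg => ?_⟩
  obtain ⟨Wa, hWa, rfl⟩ := hexp a ha hag
  obtain ⟨Wb, hWb, rfl⟩ := hexp b hb hbg
  exact (Commute.exp (hreg _ hWa _ hWb) :)

end Main

/-! ### The abstract statement -/

section Abstract

open Literature.RepresentationTheory.CompactGroups.CompactGroup in
/-- **An element with abelian centraliser** (Bröcker–tom Dieck IV (2.3)(i) with I (4.13)) for a
compact connected topological group with a faithful continuous finite-dimensional representation
(any universe): unitarise the representation (`unitarize`, Weyl's trick), apply the matrix theorem
`exists_abelian_centralizer` to its compact connected image, and pull back along the injective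
homomorphism. This is the statement of the named facts `compactLie_exists_abelian_centralizer` and
`ExistsAbelianCentralizer` (discharged in `MaximalTorusCentralizerProofs.lean` by the algebraic
road); here an independent elementary proof. [cite: BrockerTomDieck1985, IV (2.3)(i)] -/
theorem exists_abelian_centralizer_of_faithful {G : Type*} [Group G] [TopologicalSpace G]
    [IsTopologicalGroup G] [CompactSpace G] [ConnectedSpace G] (N : ℕ)
    (ρ : G →* Matrix (Fin N) (Fin N) ℂ) (hρ : Continuous ρ) (hinj : Function.Injective ρ) :
    ∃ g₀ : G, ∀ a b : G, a * g₀ = g₀ * a → b * g₀ = g₀ * b → a * b = b * a := by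
  classical
  set σ := unitarize ρ hρ with hσ
  have hσc : Continuous σ := continuous_unitarize ρ hρ
  have hB := isUnit_det_unitarizer ρ hρ
  have hσinj : Function.Injective σ := by
    intro a b h
    apply hinj
    have key : ∀ g, ρ g = (unitarizer ρ hρ)⁻¹ * σ g * unitarizer ρ hρ := fun g => by
      rw [hσ, unitarize_apply, show (unitarizer ρ hρ)⁻¹ * (unitarizer ρ hρ * ρ g * (unitarizer ρ hρ)⁻¹) *
          unitarizer ρ hρ = ((unitarizer ρ hρ)⁻¹ * unitarizer ρ hρ) * ρ g *
          ((unitarizer ρ hρ)⁻¹ * unitarizer ρ hρ) by simp only [Matrix.mul_assoc],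
        Matrix.nonsing_inv_mul _ hB, Matrix.one_mul, Matrix.mul_one]
    rw [key a, key b, h]
  set S : Set (Matrix (Fin N) (Fin N) ℂ) := Set.range σ with hS_def
  have hS : IsClosedUnitaryGroup S :=
    { one_mem := ⟨1, map_one σ⟩
      mul_mem := by rintro _ _ ⟨a, rfl⟩ ⟨b, rfl⟩; exact ⟨a * b, map_mul σ a b⟩
      star_mem := by
        rintro _ ⟨a, rfl⟩
        refine ⟨a⁻¹, ?_⟩
        rw [hσ, unitarize_inv, Matrix.star_eq_conjTranspose]
      mem_unitary := by rintro _ ⟨a, rfl⟩; exact unitarize_mem_unitaryGroup ρ hρ a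
      isClosed := (isCompact_range hσc).isClosed }
  have hconn : IsPreconnected S := isPreconnected_range hσc
  obtain ⟨_, ⟨g₀, rfl⟩, h⟩ := exists_abelian_centralizer hS hconn
  refine ⟨g₀, fun a b ha hb => hσinj ?_⟩
  rw [map_mul, map_mul]
  exact h _ ⟨a, rfl⟩ _ ⟨b, rfl⟩ (by rw [← map_mul, ha, map_mul]) (by rw [← map_mul, hb, map_mul])

end Abstract

end MatrixLie

end Literature.RepresentationTheory.CompactGroups
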